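import Literature.MathematicalPhysics.StatisticalMechanics.StickyDiscUniqueGroundStates
import HarnessLib

/-!
# Sticky disc: particle numbers with NON-unique ground states (De Luca–Friesecke 2017, §2 ¶1)

Topic `Literature/MathematicalPhysics/StatisticalMechanics`; companion of `StickyDiscUniqueGroundStates.lean`
(`IsUniqueUpToRigidMotion N`, the named fact `LucaFriesecke2017_uniqueness`: uniqueness up to rotation and
translation iff `N` is of the forms (a) `3s² + 3s + 1` / (b) `3s² + 3s + 1 + (s+1)k + s`, `k ≤ 4`).
De Luca–Friesecke prove the "only if" half [LucaFriesecke2017, §2, first paragraph (p0005)] by exhibiting,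
for every other `N`, a second minimizer that "is not a rotated translate of the canonical one": a side of
the central hexagon of Heitmann–Radin's canonical configuration is moved on top of another side, leaving
defect measure, Euler characteristic and perimeter unchanged.

This file formalizes the MECHANISM of such non-uniqueness proofs and two instances:

* `isMaximalDiscConfig_of_adjCount_eq` — a label set `S ⊂ ℤ²` with `adjCount S = 2·[3N − √(12N−3)]`,
  labelled, is a ground state of `N = #S` sticky discs (Harborth's bound, tree);
* `card_filter_degree_eq_of_rigid` — **a rigid motion carrying `triPoint '' S₁` onto `triPoint '' S₂`
  preserves, for every `d`, the number of labels with exactly `d` lattice neighbours** (isometries preserve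
  unit distances); hence
* `not_isUniqueUpToRigidMotion_of_card_filter_ne` — two maximal label sets of cardinality `N` with different
  numbers of `d`-valent labels witness `¬ IsUniqueUpToRigidMotion N`;
* `not_isUniqueUpToRigidMotion_six` (`N = 6 = 3·1² + 3·1`: Harborth's `config 1 5`, a disc with five
  neighbours, versus the triangle of side `3`, which has no `5`-valent disc) and
  `not_isUniqueUpToRigidMotion_nine` (`N = 9 = 7 + 2`: `config 2 2` has one `2`-valent disc, the `3 × 3`
  rhombus has two) — the two smallest particle numbers `≥ 2` outside the list `1, 2, 3, 4, 5, 7, 8, 10, 12, …`,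
  consistent with `not_isUniqueParticleNumber_six`.

Appended (gen 7): the infinite family `not_isUniqueUpToRigidMotion_hexagonal_add_one` —
**`N = 3s² + 3s + 2`, `s ≥ 2` (hexagonal number plus one) has non-unique ground states**: the hexagon with
one tooth (`config (s+1) 1`, one `2`-valent disc) versus the hexagon with a corner removed and two adjacent
teeth (no `2`-valent disc); `three_le_card_filter_adj_hexagon` (every label of `H_s` has `≥ 3` neighbours);
`not_isUniqueParticleNumber_hexagonal_add_one`; `uniqueness_iff_of_le_ten` — **Theorem 1.1 verified
for all `N ≤ 10`**; and the second infinite family `not_isUniqueUpToRigidMotion_hexagonal_add_mul` —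
**`N = 3s² + 3s + 1 + (s+1)k`, `1 ≤ k ≤ 5`, `s ≥ 2`**: Harborth's spiral `config (s+1) (k(s+1))` ends at a
corner of the new ring (its only `2`-valent disc), the arc shifted by one position has none
(`adj_ringPoint_succ`, `incr_add_one_le_card`: a non-final ring label has `≥ incr + 1` neighbours);
`card_filter_degree_insert` / `_erase` — the local bookkeeping of `d`-valent counts under one insertion or
erasure (only neighbours of the moved label change); and the third infinite family
`not_isUniqueUpToRigidMotion_hexagonal_add_mul_add` — **`N = 3s² + 3s + 1 + (s+1)k + j`, `k ≤ 3`,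
`1 ≤ j ≤ s − 2`, `s ≥ 3` (`(k, j) ≠ (0, 1)`)** (below); `N = 11, 13, 15, 17, 18` by enumeration and
`N = 23, 26, 29, 32, 35, 36` likewise, and `uniqueness_iff_of_le_twentyone` / `uniqueness_iff_of_le_thirtyeight` —
**Theorem 1.1 verified for all `N ≤ 38`**; third family: the spiral `config (s+1) (k(s+1)+j)` versus
`config (s+1) (k(s+1)+j+1)` with the hexagon corner `K₅ = (−s, 0)` removed, which has exactly one more
`3`-valent disc (`card_degree_three_config_succ`, `card_degree_three_erase_corner_five`, by the local
bookkeeping: the inner neighbours of an arc label in the interior of a side are non-corner boundary labels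
of `H_s`, `exists_inner_nbrs`, `four_le_card_filter_adj_hexagon`).

Together: the "only if" direction is proved for all `N = 3s² + 3s + 1 + (s+1)k + j` with `s ≥ 3`, `k ≤ 3`,
`0 ≤ j ≤ s − 2`, `(k, j) ≠ (0, 0)`, for `j = 0`, `k ≤ 5`, `s ≥ 2`, and for `N = 6, 9`.  STILL OPEN here:
`j = s − 1` (all `k`), `k ∈ {4, 5}` with `1 ≤ j ≤ s − 1`, and the remaining `s ≤ 2` cases — the general
"only if" direction of Theorem 1.1 is NOT yet complete.
Everything is proved; no new facts (D-0026).
-/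

noncomputable section

open Set Function

namespace Literature.MathematicalPhysics.StatisticalMechanics.LucaFriesecke2017

open Literature.Geometry.DiscreteGeometry (IsMaximalDiscConfig contactPairCount harborthNumber
  contactPairCount_le_harborthNumber two_mul_contactPairCount_triPoint pairwise_one_le_dist_triPoint)
open Literature.Geometry.DiscreteGeometry.HarborthSpiral (Adj adjCount config card_config
  harborthNumber_of_ring dist_triPoint_eq_one_iff)
open Theil2006 (Plane triPoint triPoint_injective)

/-! ## Label sets attaining Harborth's bound are ground states -/

/-- **A label set with `[3N − √(12N−3)]` contacts, labelled, is a ground state** of `N = #S` sticky discs: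
it is hard (distinct lattice points are `≥ 1` apart) and no hard configuration has more contacts
(Harborth's bound, `contactPairCount_le_harborthNumber`). [cite: LucaFriesecke2017, §2 (p0005)]
[cite: Harborth1974, (5)–(6) p. 15] -/
theorem isMaximalDiscConfig_of_adjCount_eq {S : Finset (ℤ × ℤ)} {N : ℕ} (hcard : S.card = N)
    (hS : (adjCount S : ℤ) = 2 * harborthNumber N) :
    IsMaximalDiscConfig (fun i : Fin N => triPoint ((S.equivFinOfCardEq hcard).symm i : ℤ × ℤ)) := by
  classical
  set e := S.equivFinOfCardEq hcard with he
  let c : Fin N → ℤ × ℤ := fun i => (e.symm i : ℤ × ℤ)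
  have hc : Function.Injective c := fun i j h => e.symm.injective (Subtype.val_injective h)
  have himage : Finset.univ.image c = S := by
    ext q
    simp only [Finset.mem_image, Finset.mem_univ, true_and, c]
    constructor
    · rintro ⟨i, rfl⟩
      exact (e.symm i).2
    · intro hq
      exact ⟨e ⟨q, hq⟩, by simp⟩
  refine ⟨pairwise_one_le_dist_triPoint hc, fun y hy => ?_⟩
  have h2 := two_mul_contactPairCount_triPoint c hc
  rw [himage] at h2
  have hcount : ((contactPairCount fun i => triPoint (c i) : ℕ) : ℤ) = harborthNumber N := by
    have : (2 : ℤ) * contactPairCount (fun i => triPoint (c i)) = adjCount S := by exact_mod_cast h2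
    linarith
  have hle := contactPairCount_le_harborthNumber y hy
  rw [← hcount] at hle
  have hle' : contactPairCount y ≤ contactPairCount fun i => triPoint (c i) := by exact_mod_cast hle
  exact hle'

/-- The particle set of the labelled configuration of `S` is `triPoint '' S`. [cite: LucaFriesecke2017, §2 (p0005)] -/
theorem range_triPoint_equivFin {S : Finset (ℤ × ℤ)} {N : ℕ} (hcard : S.card = N) :
    Set.range (fun i : Fin N => triPoint ((S.equivFinOfCardEq hcard).symm i : ℤ × ℤ)) =
      triPoint '' (↑S : Set (ℤ × ℤ)) := by
  ext p
  simp only [Set.mem_range, Set.mem_image, Finset.mem_coe]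
  constructor
  · rintro ⟨i, rfl⟩
    exact ⟨_, ((S.equivFinOfCardEq hcard).symm i).2, rfl⟩
  · rintro ⟨q, hq, rfl⟩
    exact ⟨S.equivFinOfCardEq hcard ⟨q, hq⟩, by simp⟩

/-- Harborth's identity for the spiral configuration: `2·[3N − √(12N−3)] = adjCount (config r a)` for
`N = 3r² − 3r + 1 + a`, `r ≥ 1`, `a < 6r`. [cite: Harborth1974, (6) p. 15] -/
theorem two_mul_harborthNumber_eq_adjCount_config {r a N : ℕ} (hr : 1 ≤ r) (ha : a < 6 * r)
    (hN : (N : ℤ) = 3 * (r : ℤ) ^ 2 - 3 * r + 1 + a) :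
    2 * harborthNumber N = adjCount (config r a) := by
  rw [(card_config hr ha.le).2, harborthNumber_of_ring hr ha hN]

/-! ## Rigid motions preserve the numbers of `d`-valent discs -/

/-- The number of unit-distance neighbours of `triPoint p` inside `triPoint '' S` is the number of lattice
neighbours of `p` in `S`. [cite: HeitmannRadin1980, §2 (p. 283)] -/
theorem card_filter_dist_triPoint (S : Finset (ℤ × ℤ)) (p : ℤ × ℤ) :
    ((S.image triPoint).filter fun t => dist (triPoint p) t = 1).card = (S.filter (Adj p)).card := by
  classical
  have h : (S.image triPoint).filter (fun t => dist (triPoint p) t = 1) = (S.filter (Adj p)).image triPoint := by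
    ext t
    simp only [Finset.mem_filter, Finset.mem_image]
    constructor
    · rintro ⟨⟨q, hq, rfl⟩, hd⟩
      exact ⟨q, ⟨hq, (dist_triPoint_eq_one_iff p q).1 hd⟩, rfl⟩
    · rintro ⟨q, ⟨hq, hadj⟩, rfl⟩
      exact ⟨⟨q, hq, rfl⟩, (dist_triPoint_eq_one_iff p q).2 hadj⟩
  rw [h, Finset.card_image_of_injective _ triPoint_injective]

/-- A rotation followed by a translation preserves the number of unit-distance neighbours.
[cite: LucaFriesecke2017, §2 (p0005)] -/
theorem card_filter_dist_image_rigid (T : Finset Plane) (R : Plane ≃ₗᵢ[ℝ] Plane) (a : Plane) (t : Plane) :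
    ((T.image fun p => R p + a).filter fun t' => dist (R t + a) t' = 1).card =
      (T.filter fun t' => dist t t' = 1).card := by
  classical
  have hinj : Function.Injective fun p : Plane => R p + a := fun p q h => R.injective (add_right_cancel h)
  have hiso : ∀ p q : Plane, dist (R p + a) (R q + a) = dist p q := fun p q => by
    rw [dist_add_right, R.dist_map]
  have h : (T.image fun p => R p + a).filter (fun t' => dist (R t + a) t' = 1) =
      (T.filter fun t' => dist t t' = 1).image fun p => R p + a := by
    ext x
    simp only [Finset.mem_filter, Finset.mem_image]
    constructor
    · rintro ⟨⟨q, hq, rfl⟩, hd⟩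
      exact ⟨q, ⟨hq, by rwa [hiso] at hd⟩, rfl⟩
    · rintro ⟨q, ⟨hq, hd⟩, rfl⟩
      exact ⟨⟨q, hq, rfl⟩, by rwa [hiso]⟩
  rw [h, Finset.card_image_of_injective _ hinj]

/-- **Degree counts are rigid-motion invariants.** If a rotation followed by a translation carries
`triPoint '' S₁` onto `triPoint '' S₂`, then for every `d` the two label sets have equally many labels with
exactly `d` lattice neighbours. [cite: LucaFriesecke2017, §2 (p0005) ("not a rotated translate")] -/
theorem card_filter_degree_eq_of_rigid {S₁ S₂ : Finset (ℤ × ℤ)} (R : Plane ≃ₗᵢ[ℝ] Plane) (a : Plane)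
    (h : triPoint '' (↑S₂ : Set (ℤ × ℤ)) = (fun p => R p + a) '' (triPoint '' (↑S₁ : Set (ℤ × ℤ))))
    (d : ℕ) :
    (S₁.filter fun p => (S₁.filter (Adj p)).card = d).card =
      (S₂.filter fun p => (S₂.filter (Adj p)).card = d).card := by
  classical
  set F : Plane → Plane := fun p => R p + a with hF
  have hinj : Function.Injective F := fun p q h => R.injective (add_right_cancel h)
  set T₁ := S₁.image triPoint with hT₁
  set T₂ := S₂.image triPoint with hT₂
  -- the particle finsets correspond under `F`
  have hT : T₂ = T₁.image F := by
    apply Finset.coe_injective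
    rw [hT₂, hT₁, Finset.coe_image, Finset.coe_image, Finset.coe_image, h]
  -- degree-`d` particles on the plane side
  have hdeg : ∀ (S : Finset (ℤ × ℤ)),
      (S.filter fun p => (S.filter (Adj p)).card = d).card =
        ((S.image triPoint).filter fun t => ((S.image triPoint).filter fun t' => dist t t' = 1).card = d).card := by
    intro S
    have : (S.image triPoint).filter (fun t => ((S.image triPoint).filter fun t' => dist t t' = 1).card = d) =
        (S.filter fun p => (S.filter (Adj p)).card = d).image triPoint := by
      ext t
      simp only [Finset.mem_filter, Finset.mem_image]
      constructor
      · rintro ⟨⟨q, hq, rfl⟩, hd⟩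
        exact ⟨q, ⟨hq, by rwa [card_filter_dist_triPoint] at hd⟩, rfl⟩
      · rintro ⟨q, ⟨hq, hd⟩, rfl⟩
        exact ⟨⟨q, hq, rfl⟩, by rwa [card_filter_dist_triPoint]⟩
    rw [this, Finset.card_image_of_injective _ triPoint_injective]
  rw [hdeg S₁, hdeg S₂, ← hT₁, ← hT₂, hT]
  -- `F` carries the degree-`d` particles of `T₁` onto those of `F(T₁)`
  have : (T₁.image F).filter (fun t => ((T₁.image F).filter fun t' => dist t t' = 1).card = d) =
      (T₁.filter fun t => (T₁.filter fun t' => dist t t' = 1).card = d).image F := by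
    ext x
    simp only [Finset.mem_filter, Finset.mem_image]
    constructor
    · rintro ⟨⟨q, hq, rfl⟩, hd⟩
      exact ⟨q, ⟨hq, by rwa [card_filter_dist_image_rigid] at hd⟩, rfl⟩
    · rintro ⟨q, ⟨hq, hd⟩, rfl⟩
      exact ⟨⟨q, hq, rfl⟩, by rwa [card_filter_dist_image_rigid]⟩
  rw [this, Finset.card_image_of_injective _ hinj]

/-- **Non-uniqueness criterion.** Two label sets of cardinality `N`, both with `[3N − √(12N−3)]` contacts,
having different numbers of `d`-valent labels for some `d`, are two ground states of `N` sticky discs not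
related by a rotation and a translation. [cite: LucaFriesecke2017, §2 (p0005)] -/
theorem not_isUniqueUpToRigidMotion_of_card_filter_ne {N : ℕ} {S₁ S₂ : Finset (ℤ × ℤ)}
    (h₁ : S₁.card = N) (h₂ : S₂.card = N)
    (hm₁ : (adjCount S₁ : ℤ) = 2 * harborthNumber N) (hm₂ : (adjCount S₂ : ℤ) = 2 * harborthNumber N)
    (d : ℕ) (hne : (S₁.filter fun p => (S₁.filter (Adj p)).card = d).card ≠
      (S₂.filter fun p => (S₂.filter (Adj p)).card = d).card) :
    ¬ IsUniqueUpToRigidMotion N := by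
  intro hU
  obtain ⟨R, a, -, hrange⟩ :=
    hU _ _ (isMaximalDiscConfig_of_adjCount_eq h₁ hm₁) (isMaximalDiscConfig_of_adjCount_eq h₂ hm₂)
  rw [range_triPoint_equivFin h₁, range_triPoint_equivFin h₂] at hrange
  exact hne (card_filter_degree_eq_of_rigid R a hrange d)

/-! ## Instances: `N = 6` and `N = 9` -/

/-- The triangle of side `3`: labels `(m, n)`, `m, n ≥ 0`, `m + n ≤ 2` (rows of `3, 2, 1` discs; `9` contacts).
[cite: LucaFriesecke2017, §2 (p0005)] -/
theorem adjCount_triangle_six :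
    adjCount ({((0 : ℤ), (0 : ℤ)), (1, 0), (2, 0), (0, 1), (1, 1), (0, 2)} : Finset (ℤ × ℤ)) = 18 := by
  decide +kernel

/-- **`N = 6`: the ground state is NOT unique up to rotation and translation** — Harborth's spiral
configuration `config 1 5` (a disc and five of its neighbours) has a `5`-valent disc, the triangle of side
`3` has none; both have `9 = [18 − √69]` contacts. (`6 ∉ {1, 2, 3, 4, 5, 7, 8, 10, …}`,
`not_isUniqueParticleNumber_six`.) [cite: LucaFriesecke2017, Theorem 1.1 and §2 (p0003, p0005)] -/
theorem not_isUniqueUpToRigidMotion_six : ¬ IsUniqueUpToRigidMotion 6 := by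
  have hB : 2 * harborthNumber 6 = adjCount (config 1 5) :=
    two_mul_harborthNumber_eq_adjCount_config (r := 1) (a := 5) (by norm_num) (by norm_num) (by norm_num)
  have hc : adjCount (config 1 5) = 18 := by decide +kernel
  refine not_isUniqueUpToRigidMotion_of_card_filter_ne (S₁ := config 1 5)
    (S₂ := {((0 : ℤ), (0 : ℤ)), (1, 0), (2, 0), (0, 1), (1, 1), (0, 2)}) (by decide +kernel) (by decide +kernel)
    hB.symm (by rw [hB, hc, adjCount_triangle_six]) 5 ?_
  decide +kernel

/-- The `3 × 3` rhombus: labels `(m, n)`, `0 ≤ m, n ≤ 2` (`16` contacts). [cite: LucaFriesecke2017, §2 (p0005)] -/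
theorem adjCount_rhombus_nine :
    adjCount ({((0 : ℤ), (0 : ℤ)), (1, 0), (2, 0), (0, 1), (1, 1), (2, 1), (0, 2), (1, 2), (2, 2)} :
      Finset (ℤ × ℤ)) = 32 := by
  decide +kernel

/-- **`N = 9`: the ground state is NOT unique up to rotation and translation** — Harborth's `config 2 2`
(the hexagon `H₁` and two more discs) has exactly one `2`-valent disc, the `3 × 3` rhombus has two; both
have `16 = [27 − √105]` contacts. (`9 = 3·1² + 3·1 + 1 + 2·1 + 0` is not of the forms (a)/(b).)
[cite: LucaFriesecke2017, Theorem 1.1 and §2 (p0003, p0005)] -/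
theorem not_isUniqueUpToRigidMotion_nine : ¬ IsUniqueUpToRigidMotion 9 := by
  have hB : 2 * harborthNumber 9 = adjCount (config 2 2) :=
    two_mul_harborthNumber_eq_adjCount_config (r := 2) (a := 2) (by norm_num) (by norm_num) (by norm_num)
  have hc : adjCount (config 2 2) = 32 := by decide +kernel
  refine not_isUniqueUpToRigidMotion_of_card_filter_ne (S₁ := config 2 2)
    (S₂ := {((0 : ℤ), (0 : ℤ)), (1, 0), (2, 0), (0, 1), (1, 1), (2, 1), (0, 2), (1, 2), (2, 2)})
    (by decide +kernel) (by decide +kernel) hB.symm (by rw [hB, hc, adjCount_rhombus_nine]) 2 ?_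
  decide +kernel

/-! ## An infinite family: `N = 3s² + 3s + 2`, `s ≥ 2` (the hexagonal numbers plus one)

For `s ≥ 2` the number `N = 3s² + 3s + 2 = (3s² + 3s + 1) + 1` is not of the forms (a)/(b)
(`not_isUniqueParticleNumber_hexagonal_add_one`), and two maximal label sets with different numbers of
`2`-valent labels are: `S₁ = H_s ∪ {t₁}`, the hexagon with ONE tooth `t₁ = (−s, s+1)` (Harborth's
`config (s+1) 1`; the tooth is its only `2`-valent label), and `S₂ = (H_s ∖ {c}) ∪ {t₁, t₂}`, the hexagon
with the corner `c = (0, −s)` removed (`−3` contacts) and TWO adjacent teeth `t₁, t₂ = (1−s, s+1)` added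
(`+2 + 3` contacts), which has no `2`-valent label.  Both have `9s² + 3s + 2 = [3N − √(12N−3)]` contacts. -/

open Literature.Geometry.DiscreteGeometry.HarborthSpiral (hexagon mem_hexagon Inside card_filter_adj ind
  adjCount_insert not_adj_self adj_comm adj_iff_mem_nbrs nbrs count_hexagon ringContacts ι)

/-- Every label of the hexagon `H_s` (`s ≥ 1`) has at least three lattice neighbours in `H_s` (corners
exactly three). [cite: HeitmannRadin1980, §3 (p. 283)] -/
theorem three_le_card_filter_adj_hexagon {s : ℕ} (hs : 1 ≤ s) {q : ℤ × ℤ} (hq : q ∈ hexagon s) :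
    3 ≤ ((hexagon s).filter (Adj q)).card := by
  obtain ⟨m, n⟩ := q
  rw [mem_hexagon] at hq
  simp only [Inside] at hq
  rw [card_filter_adj]
  simp only [ind, mem_hexagon, Inside]
  split_ifs <;> omega

/-- Adding labels does not decrease the number of neighbours. [folklore] -/
private theorem card_filter_adj_mono {S T : Finset (ℤ × ℤ)} (h : S ⊆ T) (q : ℤ × ℤ) :
    (S.filter (Adj q)).card ≤ (T.filter (Adj q)).card :=
  Finset.card_le_card (Finset.filter_subset_filter _ h)

/-- Removing one label costs each other label at most one neighbour, and nothing if they do not touch.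
[folklore] -/
private theorem card_filter_adj_erase (S : Finset (ℤ × ℤ)) (c q : ℤ × ℤ) :
    (S.filter (Adj q)).card ≤ ((S.erase c).filter (Adj q)).card + 1 ∧
      (¬ Adj q c → ((S.erase c).filter (Adj q)).card = (S.filter (Adj q)).card) := by
  classical
  rw [Finset.filter_erase]
  refine ⟨?_, fun h => ?_⟩
  · have := Finset.pred_card_le_card_erase (s := S.filter (Adj q)) (a := c)
    omega
  · rw [Finset.erase_eq_of_notMem]
    exact fun hc => h (Finset.mem_filter.1 hc).2

/-- `adjCount` of a set through one of its labels: `adjCount S = adjCount (S ∖ c) + 2·#N_{S∖c}(c)`.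
[cite: Harborth1974, p. 15] -/
private theorem adjCount_eq_erase_add {S : Finset (ℤ × ℤ)} {c : ℤ × ℤ} (hc : c ∈ S) :
    adjCount S = adjCount (S.erase c) + 2 * ((S.erase c).filter (Adj c)).card := by
  conv_lhs => rw [← Finset.insert_erase hc]
  exact adjCount_insert (Finset.notMem_erase c S)

section Family

variable {s : ℕ}

/-- The corner `c = (0, −s)` lies in `H_s`. [cite: HeitmannRadin1980, §3 (p. 283)] -/
private theorem corner_mem : ((0 : ℤ), -(s : ℤ)) ∈ hexagon s := by
  rw [mem_hexagon]; simp only [Inside]; omega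

/-- The teeth `t₁ = (−s, s+1)`, `t₂ = (1−s, s+1)` lie outside `H_s`. [cite: HeitmannRadin1980, §3 (p. 283)] -/
private theorem tooth_not_mem (m : ℤ) : (m, (s : ℤ) + 1) ∉ hexagon s := by
  rw [mem_hexagon]; simp only [Inside]; omega

/-- The corner `c = (0, −s)` of `H_s` has exactly three neighbours in `H_s` (`s ≥ 1`).
[cite: HeitmannRadin1980, §3 (p. 283)] -/
private theorem card_filter_adj_corner (hs : 1 ≤ s) :
    ((hexagon s).filter (Adj ((0 : ℤ), -(s : ℤ)))).card = 3 := by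
  rw [card_filter_adj]
  simp only [ind, mem_hexagon, Inside]
  split_ifs <;> omega

/-- A label of `H_s` touching the corner `c = (0, −s)` has at least four neighbours in `H_s` (`s ≥ 2`):
it is `(1, −s)`, `(0, 1−s)` or `(−1, 1−s)`. [cite: HeitmannRadin1980, §3 (p. 283)] -/
private theorem four_le_card_filter_adj_of_adj_corner (hs : 2 ≤ s) {q : ℤ × ℤ} (hq : q ∈ hexagon s)
    (hadj : Adj q ((0 : ℤ), -(s : ℤ))) : 4 ≤ ((hexagon s).filter (Adj q)).card := by
  obtain ⟨m, n⟩ := q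
  rw [adj_comm, adj_iff_mem_nbrs] at hadj
  rw [mem_hexagon] at hq
  simp only [Inside] at hq
  simp only [nbrs, Finset.mem_insert, Finset.mem_singleton, Prod.mk.injEq] at hadj
  rw [card_filter_adj]
  simp only [ind, mem_hexagon, Inside]
  split_ifs <;> omega

/-- The tooth `t₁ = (−s, s+1)` touches exactly two labels of `H_s` (the corner `(−s, s)` and `(1−s, s)`),
`s ≥ 1`. [cite: Harborth1974, p. 15 (first disc of a ring)] -/
private theorem card_filter_adj_tooth₁ (hs : 1 ≤ s) :
    ((hexagon s).filter (Adj (-(s : ℤ), (s : ℤ) + 1))).card = 2 := by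
  rw [card_filter_adj]
  simp only [ind, mem_hexagon, Inside]
  split_ifs <;> omega

/-- In `S₁ = H_s ∪ {t₁}` the tooth has exactly two neighbours. [cite: Harborth1974, p. 15] -/
private theorem card_filter_adj_S₁_tooth (hs : 1 ≤ s) :
    ((insert (-(s : ℤ), (s : ℤ) + 1) (hexagon s)).filter (Adj (-(s : ℤ), (s : ℤ) + 1))).card = 2 := by
  rw [Finset.filter_insert, if_neg (not_adj_self _), card_filter_adj_tooth₁ hs]

/-- `#S₁ = 3s² + 3s + 2`. [cite: Harborth1974, p. 15] -/
private theorem card_S₁ (s : ℕ) :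
    (insert (-(s : ℤ), (s : ℤ) + 1) (hexagon s)).card = 3 * s ^ 2 + 3 * s + 2 := by
  rw [Finset.card_insert_of_notMem (tooth_not_mem _), (count_hexagon s).1]

/-- `adjCount S₁ = 18s² + 6s + 4`. [cite: Harborth1974, p. 15] -/
private theorem adjCount_S₁ (hs : 1 ≤ s) :
    (adjCount (insert (-(s : ℤ), (s : ℤ) + 1) (hexagon s)) : ℤ) = 18 * (s : ℤ) ^ 2 + 6 * s + 4 := by
  rw [adjCount_insert (tooth_not_mem _), card_filter_adj_tooth₁ hs]
  have h := (count_hexagon s).2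
  push_cast
  linarith

/-- In `S₁` exactly one label — the tooth — has two neighbours. [cite: LucaFriesecke2017, §2 (p0005)] -/
private theorem card_degree_two_S₁ (hs : 1 ≤ s) :
    ((insert (-(s : ℤ), (s : ℤ) + 1) (hexagon s)).filter fun p =>
      ((insert (-(s : ℤ), (s : ℤ) + 1) (hexagon s)).filter (Adj p)).card = 2).card = 1 := by
  classical
  rw [Finset.card_eq_one]
  refine ⟨(-(s : ℤ), (s : ℤ) + 1), ?_⟩
  ext p
  simp only [Finset.mem_filter, Finset.mem_insert, Finset.mem_singleton]
  constructor
  · rintro ⟨hp | hp, hdeg⟩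
    · exact hp
    · exfalso
      have h3 := three_le_card_filter_adj_hexagon hs hp
      have hmono := card_filter_adj_mono (Finset.subset_insert (-(s : ℤ), (s : ℤ) + 1) (hexagon s)) p
      omega
  · rintro rfl
    exact ⟨Or.inl rfl, card_filter_adj_S₁_tooth hs⟩

/-- `t₁` touches exactly two labels of `H_s ∖ {c}` (`s ≥ 1`). [cite: Harborth1974, p. 15] -/
private theorem card_filter_adj_erase_tooth₁ (hs : 1 ≤ s) :
    (((hexagon s).erase ((0 : ℤ), -(s : ℤ))).filter (Adj (-(s : ℤ), (s : ℤ) + 1))).card = 2 := by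
  rw [card_filter_adj]
  simp only [ind, Finset.mem_erase, mem_hexagon, Inside, ne_eq, Prod.mk.injEq]
  split_ifs <;> omega

/-- `t₂ = (1−s, s+1)` touches exactly three labels of `(H_s ∖ {c}) ∪ {t₁}` (`s ≥ 2`): `t₁`, `(1−s, s)`,
`(2−s, s)`. [cite: Harborth1974, p. 15] -/
private theorem card_filter_adj_insert_tooth₂ (hs : 2 ≤ s) :
    ((insert (-(s : ℤ), (s : ℤ) + 1) ((hexagon s).erase ((0 : ℤ), -(s : ℤ)))).filter
      (Adj (1 - (s : ℤ), (s : ℤ) + 1))).card = 3 := by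
  rw [card_filter_adj]
  simp only [ind, Finset.mem_insert, Finset.mem_erase, mem_hexagon, Inside, ne_eq, Prod.mk.injEq, and_true]
  simp (disch := omega) only [if_pos, if_neg]

/-- `#S₂ = 3s² + 3s + 2`. [cite: LucaFriesecke2017, §2 (p0005)] -/
private theorem card_S₂ (hs : 1 ≤ s) :
    (insert (1 - (s : ℤ), (s : ℤ) + 1) (insert (-(s : ℤ), (s : ℤ) + 1)
      ((hexagon s).erase ((0 : ℤ), -(s : ℤ))))).card = 3 * s ^ 2 + 3 * s + 2 := by
  rw [Finset.card_insert_of_notMem, Finset.card_insert_of_notMem, Finset.card_erase_of_mem corner_mem,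
    (count_hexagon s).1]
  · have : 1 ≤ 3 * s ^ 2 + 3 * s + 1 := by omega
    omega
  · rw [Finset.mem_erase, not_and_or]; exact Or.inr (tooth_not_mem _)
  · simp only [Finset.mem_insert, Finset.mem_erase, Prod.mk.injEq, not_or, not_and_or]
    exact ⟨by omega, Or.inr (tooth_not_mem _)⟩

/-- `adjCount S₂ = 18s² + 6s + 4` (`s ≥ 2`): `18s² + 6s − 2·3 + 2·2 + 2·3`. [cite: LucaFriesecke2017, §2 (p0005)] -/
private theorem adjCount_S₂ (hs : 2 ≤ s) :
    (adjCount (insert (1 - (s : ℤ), (s : ℤ) + 1) (insert (-(s : ℤ), (s : ℤ) + 1)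
      ((hexagon s).erase ((0 : ℤ), -(s : ℤ))))) : ℤ) = 18 * (s : ℤ) ^ 2 + 6 * s + 4 := by
  have h1 : (1 - (s : ℤ), (s : ℤ) + 1) ∉ insert (-(s : ℤ), (s : ℤ) + 1)
      ((hexagon s).erase ((0 : ℤ), -(s : ℤ))) := by
    simp only [Finset.mem_insert, Finset.mem_erase, Prod.mk.injEq, not_or, not_and_or]
    exact ⟨by omega, Or.inr (tooth_not_mem _)⟩
  have h2 : (-(s : ℤ), (s : ℤ) + 1) ∉ (hexagon s).erase ((0 : ℤ), -(s : ℤ)) := by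
    rw [Finset.mem_erase, not_and_or]; exact Or.inr (tooth_not_mem _)
  have h3 := adjCount_eq_erase_add (corner_mem (s := s))
  have h4 : (((hexagon s).erase ((0 : ℤ), -(s : ℤ))).filter (Adj ((0 : ℤ), -(s : ℤ)))).card = 3 := by
    rw [(card_filter_adj_erase _ _ _).2 (not_adj_self _), card_filter_adj_corner (by omega)]
  rw [adjCount_insert h1, adjCount_insert h2, card_filter_adj_insert_tooth₂ hs,
    card_filter_adj_erase_tooth₁ (by omega)]
  have h5 := (count_hexagon s).2
  rw [h3, h4] at h5
  push_cast at h5 ⊢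
  linarith

/-- In `S₂` no label has exactly two neighbours (`s ≥ 2`). [cite: LucaFriesecke2017, §2 (p0005)] -/
private theorem card_degree_two_S₂ (hs : 2 ≤ s) :
    ((insert (1 - (s : ℤ), (s : ℤ) + 1) (insert (-(s : ℤ), (s : ℤ) + 1)
      ((hexagon s).erase ((0 : ℤ), -(s : ℤ))))).filter fun p =>
      ((insert (1 - (s : ℤ), (s : ℤ) + 1) (insert (-(s : ℤ), (s : ℤ) + 1)
        ((hexagon s).erase ((0 : ℤ), -(s : ℤ))))).filter (Adj p)).card = 2).card = 0 := by
  classical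
  set S₂ := insert (1 - (s : ℤ), (s : ℤ) + 1) (insert (-(s : ℤ), (s : ℤ) + 1)
    ((hexagon s).erase ((0 : ℤ), -(s : ℤ)))) with hS₂
  rw [Finset.card_eq_zero, Finset.filter_eq_empty_iff]
  intro p hp
  -- every label of `S₂` has at least three neighbours
  suffices h3 : 3 ≤ (S₂.filter (Adj p)).card by omega
  have ht₂ : (S₂.filter (Adj (1 - (s : ℤ), (s : ℤ) + 1))).card = 3 := by
    rw [hS₂, card_filter_adj]
    simp only [ind, Finset.mem_insert, Finset.mem_erase, mem_hexagon, Inside, ne_eq, Prod.mk.injEq, and_true,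
      true_and]
    simp (disch := omega) only [if_pos, if_neg]
  have ht₁ : (S₂.filter (Adj (-(s : ℤ), (s : ℤ) + 1))).card = 3 := by
    rw [hS₂, card_filter_adj]
    simp only [ind, Finset.mem_insert, Finset.mem_erase, mem_hexagon, Inside, ne_eq, Prod.mk.injEq, and_true,
      true_and]
    simp (disch := omega) only [if_pos, if_neg]
  rw [hS₂, Finset.mem_insert, Finset.mem_insert] at hp
  rcases hp with rfl | rfl | hp
  · rw [ht₂]
  · rw [ht₁]
  · -- `p ∈ H_s ∖ {c}`
    have hsub : (hexagon s).erase ((0 : ℤ), -(s : ℤ)) ⊆ S₂ := by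
      rw [hS₂]
      exact (Finset.subset_insert _ _).trans (Finset.subset_insert _ _)
    refine le_trans ?_ (card_filter_adj_mono hsub p)
    have hpH : p ∈ hexagon s := (Finset.mem_erase.1 hp).2
    obtain ⟨hle, heq⟩ := card_filter_adj_erase (hexagon s) ((0 : ℤ), -(s : ℤ)) p
    by_cases hadj : Adj p ((0 : ℤ), -(s : ℤ))
    · have h4 := four_le_card_filter_adj_of_adj_corner hs hpH hadj
      omega
    · rw [heq hadj]
      exact three_le_card_filter_adj_hexagon (by omega) hpH

/-- `ringContacts (s+1) 1 = 2`: the first disc of a ring touches two discs of the hexagon (`s ≥ 1`).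
[cite: Harborth1974, p. 15] -/
private theorem ringContacts_succ_one (hs : 1 ≤ s) : ringContacts (s + 1) 1 = 2 := by
  simp only [ringContacts, ι]
  split_ifs <;> omega

/-- `2·[3N − √(12N−3)] = 18s² + 6s + 4` for `N = 3s² + 3s + 2`, `s ≥ 1` (Harborth's identity at
`config (s+1) 1`). [cite: Harborth1974, (6) p. 15] -/
theorem two_mul_harborthNumber_hexagonal_add_one (hs : 1 ≤ s) :
    2 * harborthNumber (3 * s ^ 2 + 3 * s + 2) = 18 * (s : ℤ) ^ 2 + 6 * s + 4 := by
  have h := two_mul_harborthNumber_eq_adjCount_config (r := s + 1) (a := 1) (N := 3 * s ^ 2 + 3 * s + 2)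
    (by omega) (by omega) (by push_cast; ring)
  rw [h, (card_config (r := s + 1) (a := 1) (by omega) (by omega)).2, ringContacts_succ_one hs]
  push_cast
  ring

/-- **For every `s ≥ 2` the ground state of `N = 3s² + 3s + 2` sticky discs is NOT unique up to rotation
and translation**: the hexagon `H_s` with one tooth and the hexagon with a corner removed and two adjacent
teeth are maximal configurations with different numbers of `2`-valent discs (`1` and `0`).
(`N = 8`, `s = 1`, IS a uniqueness number: `8 = 7 + 1` is of type (b).)
[cite: LucaFriesecke2017, Theorem 1.1 and §2 (p0003, p0005)] -/
theorem not_isUniqueUpToRigidMotion_hexagonal_add_one (s : ℕ) (hs : 2 ≤ s) :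
    ¬ IsUniqueUpToRigidMotion (3 * s ^ 2 + 3 * s + 2) := by
  have hB := two_mul_harborthNumber_hexagonal_add_one (s := s) (by omega)
  refine not_isUniqueUpToRigidMotion_of_card_filter_ne (card_S₁ s) (card_S₂ (by omega))
    (by rw [hB, adjCount_S₁ (by omega)]) (by rw [hB, adjCount_S₂ hs]) 2 ?_
  rw [card_degree_two_S₁ (by omega), card_degree_two_S₂ hs]
  omega

end Family

/-- `N = 3s² + 3s + 2`, `s ≥ 2`, is not of De Luca–Friesecke's forms (a)/(b) — consistent with
`not_isUniqueUpToRigidMotion_hexagonal_add_one` and Theorem 1.1. [cite: LucaFriesecke2017, Theorem 1.1 (p0003)] -/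
theorem not_isUniqueParticleNumber_hexagonal_add_one (s : ℕ) (hs : 2 ≤ s) :
    ¬ IsUniqueParticleNumber (3 * s ^ 2 + 3 * s + 2) := by
  rintro (⟨u, hu⟩ | ⟨u, k, hk, hu⟩)
  · -- `3s² + 3s + 2 ≠ 3u² + 3u + 1` (mod 3)
    omega
  · -- `3u² + 4u + 1 + (u+1)k`: compare `u` with `s`
    rcases lt_trichotomy u s with h | rfl | h
    · have h1 : u + 1 ≤ s := h
      have : 3 * u ^ 2 + 3 * u + 1 + (u + 1) * k + u ≤ 3 * u ^ 2 + 3 * u + 1 + (u + 1) * 4 + u := by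
        have := Nat.mul_le_mul_left (u + 1) hk; omega
      nlinarith
    · have : (u + 1) * k + u = 1 := by nlinarith
      rcases Nat.eq_zero_or_pos k with rfl | hk0
      · omega
      · nlinarith
    · have h1 : s + 1 ≤ u := h
      nlinarith

/-! ## Theorem 1.1 verified for `N ≤ 10` -/

/-- `9` is not of the forms (a)/(b). [cite: LucaFriesecke2017, Theorem 1.1 (p0003)] -/
theorem not_isUniqueParticleNumber_nine : ¬ IsUniqueParticleNumber 9 := by
  rintro (⟨s, hs⟩ | ⟨s, k, hk, hs⟩)
  · have : s ≤ 2 := by nlinarith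
    interval_cases s <;> omega
  · have : s ≤ 2 := by nlinarith
    interval_cases s <;> omega

/-- **De Luca–Friesecke's Theorem 1.1 holds for `N ≤ 10`**: among `1 ≤ N ≤ 10` the minimizer is unique up
to rotation and translation exactly for `N ∈ {1, 2, 3, 4, 5, 7, 8, 10}` — the "if" direction by
`isUniqueUpToRigidMotion_of_isUniqueParticleNumber`, and `N = 6, 9` by the two non-congruent maximal
configurations above. [cite: LucaFriesecke2017, Theorem 1.1 (p0003)] -/
theorem uniqueness_iff_of_le_ten {N : ℕ} (h1 : 1 ≤ N) (h10 : N ≤ 10) :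
    IsUniqueUpToRigidMotion N ↔ IsUniqueParticleNumber N := by
  refine ⟨fun hU => ?_, isUniqueUpToRigidMotion_of_isUniqueParticleNumber⟩
  interval_cases N
  · exact Or.inl ⟨0, by norm_num⟩
  · exact Or.inr ⟨0, 1, by norm_num, by norm_num⟩
  · exact Or.inr ⟨0, 2, by norm_num, by norm_num⟩
  · exact Or.inr ⟨0, 3, by norm_num, by norm_num⟩
  · exact Or.inr ⟨0, 4, by norm_num, by norm_num⟩
  · exact absurd hU not_isUniqueUpToRigidMotion_six
  · exact Or.inl ⟨1, by norm_num⟩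
  · exact Or.inr ⟨1, 0, by norm_num, by norm_num⟩
  · exact absurd hU not_isUniqueUpToRigidMotion_nine
  · exact Or.inr ⟨1, 1, by norm_num, by norm_num⟩

open Literature.Geometry.DiscreteGeometry.HarborthSpiral

/-! ## A second infinite family: `N = 3s² + 3s + 1 + (s+1)k`, `1 ≤ k ≤ 5`, `s ≥ 2`
(`j = 0`: Harborth's spiral ends exactly at a corner of the new ring)

Harborth's `C₁ = config (s+1) (k(s+1))` — the hexagon `H_s` and the first `k(s+1)` labels of ring
`s + 1`, positions `0, …, k(s+1) − 1` — ends at the corner label at position `k(s+1) − 1`, which touches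
only one label of `H_s` and its predecessor: it is the unique `2`-valent label of `C₁`.  Shifting the arc
by one position, `C₂ = H_s ∪ {positions 1, …, k(s+1)} = config (s+1) (k(s+1)+1) ∖ {ringPoint (s+1) 0}`,
keeps the number of contacts (`3a − 1 − k` for an arc of `a` labels passing `k` corners, wherever it
starts on the first side) and has no `2`-valent label. -/

section SpiralFamily

variable {r : ℕ}

/-- Longer spiral prefixes are larger. [cite: Harborth1974, p. 15] -/
theorem config_mono {a b : ℕ} (hab : a ≤ b) : config r a ⊆ config r b := by
  intro q hq
  rw [mem_config] at hq ⊢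
  rcases hq with h | ⟨h1, h2⟩
  · exact Or.inl h
  · exact Or.inr ⟨h1, by omega⟩

/-- Consecutive labels of a ring touch. [cite: Harborth1974, p. 15] -/
theorem adj_ringPoint_succ (_hr : 1 ≤ r) {p : ℕ} (hp : p + 1 < 6 * r) :
    Adj (ringPoint r p) (ringPoint r ((p + 1 : ℕ) : ℤ)) := by
  rw [adj_iff_mem_nbrs]
  push_cast
  simp only [ringPoint]
  split_ifs <;>
    simp only [nbrs, Finset.mem_insert, Finset.mem_singleton, Prod.mk.injEq, and_true, true_and] <;> omega

/-- The first label `(1−r, r)` of ring `r ≥ 2` touches no label of the ring at positions `2, …, 6r−2`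
(its ring neighbours are the positions `1` and `6r − 1`). [cite: Harborth1974, p. 15] -/
theorem not_adj_ringPoint_zero (hr : 2 ≤ r) {q : ℤ × ℤ} (h1 : Inside r q) (h2 : ¬ Inside ((r : ℤ) - 1) q)
    (h3 : 2 ≤ pos r q) (h4 : pos r q ≤ 6 * r - 2) : ¬ Adj (ringPoint r ((0 : ℕ) : ℤ)) q := by
  obtain ⟨m, n⟩ := q
  rw [Nat.cast_zero, ringPoint_A (by omega), adj_iff_mem_nbrs]
  simp only [Inside] at h1 h2
  generalize hP : pos (r : ℤ) (m, n) = P at h3 h4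
  simp only [pos] at hP
  simp only [nbrs, Finset.mem_insert, Finset.mem_singleton, Prod.mk.injEq]
  split_ifs at hP <;> omega

/-- A ring label at position `≥ 1` not of the form (position before a corner with `r = 1`) gains at least
two contacts when placed: `incr r p ≥ 2` for `r ≥ 2`. [cite: Harborth1974, p. 15] -/
theorem two_le_incr (hr : 2 ≤ r) (p : ℕ) : 2 ≤ incr r p := by
  unfold incr
  split_ifs <;> omega

/-- **A non-final ring label has at least `incr + 1` neighbours**: the `incr r p` labels it touched when
placed and its successor on the ring. [cite: Harborth1974, p. 15] -/
theorem incr_add_one_le_card (hr : 1 ≤ r) {p a : ℕ} (hpa : p + 2 ≤ a) (ha : a ≤ 6 * r) :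
    incr r p + 1 ≤ (((config r a).filter (Adj (ringPoint r p))).card : ℤ) := by
  classical
  have hp1 : p + 1 < 6 * r := by omega
  have hp0 : p < 6 * r := by omega
  have hsub : ((config r (p + 2)).filter (Adj (ringPoint r p))) ⊆ (config r a).filter (Adj (ringPoint r p)) :=
    Finset.filter_subset_filter _ (config_mono hpa)
  have hle := Finset.card_le_card hsub
  have hnot : ringPoint (r : ℤ) ((p + 1 : ℕ) : ℤ) ∉ (config r p).filter (Adj (ringPoint r p)) := fun h =>
    ringPoint_not_mem_config hr hp1 (config_mono (Nat.le_succ p) (Finset.mem_filter.1 h).1)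
  have he : (config r (p + 2)).filter (Adj (ringPoint r p)) =
      insert (ringPoint (r : ℤ) ((p + 1 : ℕ) : ℤ)) ((config r p).filter (Adj (ringPoint r p))) := by
    rw [show p + 2 = p + 1 + 1 from rfl, config_succ hr hp1, config_succ hr hp0, Finset.filter_insert,
      if_pos (adj_ringPoint_succ hr hp1), Finset.filter_insert, if_neg (not_adj_self _)]
  rw [he, Finset.card_insert_of_notMem hnot] at hle
  have h := card_nbr_eq_incr (r := r) hp0
  omega

/-- The last label of a spiral prefix has exactly `incr` neighbours. [cite: Harborth1974, p. 15] -/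
theorem card_filter_adj_config_last (hr : 1 ≤ r) {p : ℕ} (hp : p < 6 * r) :
    (((config r (p + 1)).filter (Adj (ringPoint r p))).card : ℤ) = incr r p := by
  rw [config_succ hr hp, Finset.filter_insert, if_neg (not_adj_self _)]
  exact card_nbr_eq_incr hp

/-- A label of `config r a` outside `H_{r−1}` is a ring label `ringPoint r p`, `p < a`. [cite: Harborth1974, p. 15] -/
theorem exists_eq_ringPoint_of_mem_config (hr : 1 ≤ r) {a : ℕ} {q : ℤ × ℤ} (hq : q ∈ config r a)
    (hq' : ¬ Inside ((r : ℤ) - 1) q) :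
    ∃ p : ℕ, p < a ∧ q = ringPoint r p ∧ Inside r q ∧ pos r q = p := by
  rw [mem_config] at hq
  rcases hq with h | ⟨h1, h2⟩
  · exact absurd h hq'
  · have hr' : (1 : ℤ) ≤ r := by exact_mod_cast hr
    have h0 := (pos_nonneg_lt hr' h1 hq').1
    have hc : (((pos (r : ℤ) q).toNat : ℕ) : ℤ) = pos r q := Int.toNat_of_nonneg h0
    refine ⟨(pos r q).toNat, by omega, ?_, h1, hc.symm⟩
    rw [hc]
    exact eq_ringPoint_of_pos hr' h1 hq'

/-- `H_{r−1} = config r 0`-membership in the form `mem_config` produces. [cite: Harborth1974, p. 15] -/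
theorem mem_hexagon_pred (hr : 1 ≤ r) {q : ℤ × ℤ} : q ∈ hexagon (r - 1) ↔ Inside ((r : ℤ) - 1) q := by
  rw [mem_hexagon, Nat.cast_sub hr, Nat.cast_one]

/-- Every label of `config r a` lying in the hexagon `H_{r−1}` (`r ≥ 2`) has at least three neighbours.
[cite: HeitmannRadin1980, §3 (p. 283)] -/
theorem three_le_card_filter_adj_config_of_inside (hr : 2 ≤ r) (a : ℕ) {q : ℤ × ℤ}
    (hq : Inside ((r : ℤ) - 1) q) : 3 ≤ ((config r a).filter (Adj q)).card := by
  have hq' : q ∈ hexagon (r - 1) := (mem_hexagon_pred (by omega)).2 hq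
  have h3 := three_le_card_filter_adj_hexagon (s := r - 1) (by omega) hq'
  have hsub : hexagon (r - 1) ⊆ config r a := by
    rw [← config_zero (by omega : 1 ≤ r)]; exact config_mono (Nat.zero_le a)
  exact h3.trans (Finset.card_le_card (Finset.filter_subset_filter _ hsub))

variable {k : ℕ}

/-- `incr r (kr − 1) = 2`: the label at a corner position touches its predecessor and one inner label
(`r ≥ 2`, `1 ≤ k ≤ 5`). [cite: Harborth1974, p. 15] -/
theorem incr_corner (hr : 2 ≤ r) (hk1 : 1 ≤ k) (hk5 : k ≤ 5) : incr r (k * r - 1) = 2 := by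
  unfold incr
  interval_cases k <;> split_ifs <;> omega

/-- `incr r (kr) = 3`: the first label of a new side touches its predecessor (the corner) and two inner
labels (`r ≥ 2`, `1 ≤ k ≤ 5`). [cite: Harborth1974, p. 15] -/
theorem incr_mul (hr : 2 ≤ r) (hk1 : 1 ≤ k) (hk5 : k ≤ 5) : incr r (k * r) = 3 := by
  unfold incr
  interval_cases k <;> split_ifs <;> omega

/-- `incr r 1 = 3` for `r ≥ 3`. [cite: Harborth1974, p. 15] -/
theorem incr_one (hr : 3 ≤ r) : incr r 1 = 3 := by
  rw [incr, if_neg (by omega), if_neg (by omega)]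
  norm_num

/-- `incr r 0 = 2` for `r ≥ 2`. [cite: Harborth1974, p. 15] -/
theorem incr_zero (hr : 2 ≤ r) : incr r 0 = 2 := by
  rw [incr, if_pos rfl, if_neg (by omega)]
  norm_num

/-- `kr ≤ 5r < 6r − 2` bookkeeping (`r ≥ 2`, `k ≤ 5`). [folklore] -/
private theorem mul_le (hr : 2 ≤ r) (hk5 : k ≤ 5) : k * r + 2 ≤ 6 * r := by nlinarith

/-- **In `C₁ = config r (kr)` exactly one label — the final corner — has two neighbours**
(`r ≥ 3`, `1 ≤ k ≤ 5`). [cite: LucaFriesecke2017, §2 (p0005)] [cite: Harborth1974, p. 15] -/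
theorem card_degree_two_config_mul (hr : 3 ≤ r) (hk1 : 1 ≤ k) (hk5 : k ≤ 5) :
    ((config r (k * r)).filter fun p => ((config r (k * r)).filter (Adj p)).card = 2).card = 1 := by
  classical
  have hkr : 3 ≤ k * r := by nlinarith
  have hr2 : 2 ≤ r := by omega
  have hkr6 := mul_le hr2 hk5
  have hkr6' : k * r ≤ 6 * r := by omega
  have hr1 : 1 ≤ r := by omega
  rw [Finset.card_eq_one]
  obtain ⟨m, hm⟩ : ∃ m : ℕ, k * r = m + 1 := ⟨k * r - 1, by omega⟩
  have hm6 : m < 6 * r := by omega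
  have hincr : incr r m = 2 := by
    have := incr_corner (r := r) (by omega) hk1 hk5
    rwa [show k * r - 1 = m by omega] at this
  refine ⟨ringPoint (r : ℤ) (m : ℤ), ?_⟩
  have hlast : (((config r (k * r)).filter (Adj (ringPoint (r : ℤ) (m : ℤ)))).card : ℤ) = 2 := by
    have h := card_filter_adj_config_last hr1 hm6
    rw [← hm, hincr] at h
    exact h
  ext q
  simp only [Finset.mem_filter, Finset.mem_singleton]
  constructor
  · rintro ⟨hq, hdeg⟩
    by_cases hin : Inside ((r : ℤ) - 1) q
    · have h3 := three_le_card_filter_adj_config_of_inside (by omega) (k * r) hin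
      omega
    · obtain ⟨p, hp, hqp, -, -⟩ := exists_eq_ringPoint_of_mem_config hr1 hq hin
      by_cases hp2 : p + 2 ≤ k * r
      · have h := incr_add_one_le_card hr1 hp2 hkr6'
        have h2 := two_le_incr (by omega : 2 ≤ r) p
        rw [← hqp] at h
        omega
      · have hp' : p = m := by omega
        rw [hqp, hp']
  · rintro rfl
    refine ⟨?_, by exact_mod_cast hlast⟩
    rw [hm, config_succ hr1 hm6]
    exact Finset.mem_insert_self _ _

/-- **In `C₂ = config r (kr+1) ∖ {ringPoint r 0}` no label has two neighbours** (`r ≥ 3`, `1 ≤ k ≤ 5`).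
[cite: LucaFriesecke2017, §2 (p0005)] [cite: Harborth1974, p. 15] -/
theorem card_degree_two_config_erase (hr : 3 ≤ r) (hk1 : 1 ≤ k) (hk5 : k ≤ 5) :
    (((config r (k * r + 1)).erase (ringPoint r ((0 : ℕ) : ℤ))).filter fun p =>
      (((config r (k * r + 1)).erase (ringPoint r ((0 : ℕ) : ℤ))).filter (Adj p)).card = 2).card = 0 := by
  classical
  have hkr : 3 ≤ k * r := by nlinarith
  have hr2 : 2 ≤ r := by omega
  have hkr6 := mul_le hr2 hk5
  have hr1 : 1 ≤ r := by omega
  have hr' : (1 : ℤ) ≤ r := by exact_mod_cast hr1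
  set C₂ := (config r (k * r + 1)).erase (ringPoint r ((0 : ℕ) : ℤ)) with hC₂
  rw [Finset.card_eq_zero, Finset.filter_eq_empty_iff]
  intro q hq
  suffices h3 : 3 ≤ (C₂.filter (Adj q)).card by omega
  obtain ⟨hq0, hq⟩ := Finset.mem_erase.1 hq
  -- erasing one label costs at most one neighbour, nothing if not adjacent
  have herase : ((config r (k * r + 1)).filter (Adj q)).card ≤ (C₂.filter (Adj q)).card + 1 ∧
      (¬ Adj q (ringPoint r ((0 : ℕ) : ℤ)) → (C₂.filter (Adj q)).card = ((config r (k * r + 1)).filter (Adj q)).card) := by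
    rw [hC₂, Finset.filter_erase]
    refine ⟨?_, fun h => ?_⟩
    · have := Finset.pred_card_le_card_erase (s := (config r (k * r + 1)).filter (Adj q)) (a := ringPoint (r : ℤ) ((0 : ℕ) : ℤ))
      omega
    · rw [Finset.erase_eq_of_notMem]
      exact fun hc => h (Finset.mem_filter.1 hc).2
  by_cases hin : Inside ((r : ℤ) - 1) q
  · -- `q ∈ H_{r-1}`: three neighbours inside the hexagon, which avoids `ringPoint r 0`
    have hq' : q ∈ hexagon (r - 1) := (mem_hexagon_pred hr1).2 hin
    have h3 := three_le_card_filter_adj_hexagon (s := r - 1) (by omega) hq'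
    have hsub : hexagon (r - 1) ⊆ C₂ := by
      intro x hx
      rw [hC₂, Finset.mem_erase]
      refine ⟨fun h => ?_, ?_⟩
      · rw [← config_zero hr1, h] at hx
        exact ringPoint_not_mem_config hr1 (by omega) hx
      · rw [← config_zero hr1] at hx
        exact config_mono (Nat.zero_le _) hx
    exact h3.trans (Finset.card_le_card (Finset.filter_subset_filter _ hsub))
  · obtain ⟨p, hp, hqp, hins, hpos⟩ := exists_eq_ringPoint_of_mem_config hr1 hq hin
    have hp0 : p ≠ 0 := by rintro rfl; exact hq0 (by rw [hqp])
    by_cases hpk : p = k * r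
    · -- the last label of `C₂`: `incr r (kr) = 3` neighbours, none of them `ringPoint r 0`
      have hdeg : (((config r (k * r + 1)).filter (Adj q)).card : ℤ) = 3 := by
        rw [hqp, hpk]
        have hlt : k * r < 6 * r := by omega
        have h := card_filter_adj_config_last hr1 hlt
        rw [incr_mul (by omega) hk1 hk5] at h
        exact h
      have hna : ¬ Adj q (ringPoint r ((0 : ℕ) : ℤ)) := by
        rw [adj_comm]
        exact not_adj_ringPoint_zero (by omega) hins hin (by rw [hpos]; omega)
          (by rw [hpos, hpk]; push_cast; omega)
      rw [herase.2 hna]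
      exact_mod_cast hdeg.ge
    by_cases hp1 : p = 1
    · -- position `1`: `incr r 1 + 1 = 4` neighbours, at most one of them erased
      have h3a : 1 + 2 ≤ k * r + 1 := by omega
      have h6a : k * r + 1 ≤ 6 * r := by omega
      have h := incr_add_one_le_card hr1 h3a h6a
      rw [incr_one hr] at h
      rw [hp1] at hqp
      rw [← hqp] at h
      have := herase.1
      omega
    · -- positions `2 ≤ p ≤ kr − 1`: `incr + 1 ≥ 3` neighbours, `ringPoint r 0` not among them
      have h3a : p + 2 ≤ k * r + 1 := by omega
      have h6a : k * r + 1 ≤ 6 * r := by omega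
      have h := incr_add_one_le_card hr1 h3a h6a
      have h2 := two_le_incr (by omega : 2 ≤ r) p
      rw [← hqp] at h
      have hna : ¬ Adj q (ringPoint r ((0 : ℕ) : ℤ)) := by
        rw [adj_comm]
        exact not_adj_ringPoint_zero (by omega) hins hin (by rw [hpos]; omega)
          (by rw [hpos]; omega)
      rw [herase.2 hna]
      omega

/-- The neighbours of `ringPoint r 0` in `config r (kr+1)` are its two inner neighbours and `ringPoint r 1`:
three in all (`r ≥ 2`, `1 ≤ k ≤ 5`). [cite: Harborth1974, p. 15] -/
theorem card_filter_adj_ringPoint_zero (hr : 2 ≤ r) (hk1 : 1 ≤ k) (hk5 : k ≤ 5) :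
    ((config r (k * r + 1)).filter (Adj (ringPoint r ((0 : ℕ) : ℤ)))).card = 3 := by
  classical
  have hkr : 2 ≤ k * r := by nlinarith
  have hkr6 := mul_le (k := k) hr hk5
  have hr1 : 1 ≤ r := by omega
  have hr' : (1 : ℤ) ≤ r := by exact_mod_cast hr1
  have hnot1 : ringPoint (r : ℤ) ((1 : ℕ) : ℤ) ∉ (config r 0).filter (Adj (ringPoint r ((0 : ℕ) : ℤ))) := fun h =>
    ringPoint_not_mem_config hr1 (by omega) (config_mono (Nat.zero_le 1) (Finset.mem_filter.1 h).1)
  have he : (config r (k * r + 1)).filter (Adj (ringPoint r ((0 : ℕ) : ℤ))) =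
      insert (ringPoint (r : ℤ) ((1 : ℕ) : ℤ)) ((config r 0).filter (Adj (ringPoint r ((0 : ℕ) : ℤ)))) := by
    ext x
    simp only [Finset.mem_filter, Finset.mem_insert]
    constructor
    · rintro ⟨hx, hadj⟩
      by_cases hin : Inside ((r : ℤ) - 1) x
      · exact Or.inr ⟨by rw [config_zero hr1]; exact (mem_hexagon_pred hr1).2 hin, hadj⟩
      · obtain ⟨p, hp, hxp, hins, hpos⟩ := exists_eq_ringPoint_of_mem_config hr1 hx hin
        by_cases hp0 : p = 0
        · rw [hxp, hp0] at hadj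
          exact absurd hadj (not_adj_self _)
        by_cases hp1 : p = 1
        · left; rw [hxp, hp1]
        · exfalso
          exact not_adj_ringPoint_zero hr hins hin (by rw [hpos]; omega)
            (by rw [hpos]; omega) hadj
    · rintro (rfl | ⟨hx, hadj⟩)
      · refine ⟨config_mono (show 2 ≤ k * r + 1 by omega) ?_, ?_⟩
        · rw [show (2 : ℕ) = 1 + 1 from rfl, config_succ hr1 (by omega)]
          exact Finset.mem_insert_self _ _
        · have := adj_ringPoint_succ hr1 (p := 0) (by omega)
          simpa using this
      · exact ⟨config_mono (Nat.zero_le _) hx, hadj⟩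
  rw [he, Finset.card_insert_of_notMem hnot1]
  have h := card_nbr_eq_incr (r := r) (a := 0) (by omega)
  rw [incr_zero hr] at h
  omega

/-- `adjCount C₂ = adjCount C₁`: shifting the arc by one position keeps the number of contacts
(`r ≥ 2`, `1 ≤ k ≤ 5`). [cite: LucaFriesecke2017, §2 (p0005)] [cite: Harborth1974, p. 15] -/
theorem adjCount_config_erase (hr : 2 ≤ r) (hk1 : 1 ≤ k) (hk5 : k ≤ 5) :
    adjCount ((config r (k * r + 1)).erase (ringPoint r ((0 : ℕ) : ℤ))) = adjCount (config r (k * r)) := by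
  classical
  have hkr : 2 ≤ k * r := by nlinarith
  have hkr6 := mul_le (k := k) hr hk5
  have hr1 : 1 ≤ r := by omega
  have hmem : ringPoint (r : ℤ) ((0 : ℕ) : ℤ) ∈ config r (k * r + 1) := by
    refine config_mono (show 1 ≤ k * r + 1 by omega) ?_
    rw [show (1 : ℕ) = 0 + 1 from rfl, config_succ hr1 (by omega)]
    exact Finset.mem_insert_self _ _
  have h1 := adjCount_eq_erase_add hmem
  have h2 : (((config r (k * r + 1)).erase (ringPoint (r : ℤ) ((0 : ℕ) : ℤ))).filter
      (Adj (ringPoint (r : ℤ) ((0 : ℕ) : ℤ)))).card = 3 := by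
    rw [Finset.filter_erase, Finset.erase_eq_of_notMem, card_filter_adj_ringPoint_zero hr hk1 hk5]
    exact fun h => not_adj_self _ (Finset.mem_filter.1 h).2
  have hlt : k * r < 6 * r := by omega
  have h4 := card_nbr_eq_incr (r := r) (a := k * r) hlt
  rw [incr_mul hr hk1 hk5] at h4
  have h3 : (adjCount (config r (k * r + 1)) : ℤ) = adjCount (config r (k * r)) + 2 * 3 := by
    rw [config_succ hr1 hlt, adjCount_insert (ringPoint_not_mem_config hr1 hlt), Nat.cast_add, Nat.cast_mul,
      h4, Nat.cast_ofNat]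
  rw [h2] at h1
  omega

/-- `#C₂ = #C₁`. [cite: Harborth1974, p. 15] -/
theorem card_config_erase (hr : 2 ≤ r) (hk5 : k ≤ 5) :
    ((config r (k * r + 1)).erase (ringPoint r ((0 : ℕ) : ℤ))).card = (config r (k * r)).card := by
  have hkr6 := mul_le (k := k) hr hk5
  have hr1 : 1 ≤ r := by omega
  have hmem : ringPoint (r : ℤ) ((0 : ℕ) : ℤ) ∈ config r (k * r + 1) := by
    refine config_mono (show 1 ≤ k * r + 1 by omega) ?_
    rw [show (1 : ℕ) = 0 + 1 from rfl, config_succ hr1 (by omega)]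
    exact Finset.mem_insert_self _ _
  rw [Finset.card_erase_of_mem hmem, config_succ hr1 (by omega),
    Finset.card_insert_of_notMem (ringPoint_not_mem_config hr1 (by omega))]
  rfl

end SpiralFamily

/-- **For every `s ≥ 2` and `1 ≤ k ≤ 5` the ground state of `N = 3s² + 3s + 1 + (s+1)k` sticky discs is
NOT unique up to rotation and translation**: Harborth's spiral configuration (ending at a corner of ring
`s + 1`, one `2`-valent disc) and the same arc shifted by one position (no `2`-valent disc) are two
maximal configurations not related by a rigid motion. [cite: LucaFriesecke2017, Theorem 1.1 and §2 (p0003, p0005)] -/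
theorem not_isUniqueUpToRigidMotion_hexagonal_add_mul (s k : ℕ) (hs : 2 ≤ s) (hk1 : 1 ≤ k) (hk5 : k ≤ 5) :
    ¬ IsUniqueUpToRigidMotion (3 * s ^ 2 + 3 * s + 1 + (s + 1) * k) := by
  have hr : 3 ≤ s + 1 := by omega
  have hkr : k * (s + 1) < 6 * (s + 1) := by nlinarith
  have hN : ((3 * s ^ 2 + 3 * s + 1 + (s + 1) * k : ℕ) : ℤ) =
      3 * ((s + 1 : ℕ) : ℤ) ^ 2 - 3 * ((s + 1 : ℕ) : ℤ) + 1 + ((k * (s + 1) : ℕ) : ℤ) := by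
    push_cast; ring
  have hB := two_mul_harborthNumber_eq_adjCount_config (r := s + 1) (a := k * (s + 1)) (by omega) hkr hN
  have hc1 : (config (s + 1) (k * (s + 1))).card = 3 * s ^ 2 + 3 * s + 1 + (s + 1) * k := by
    have h := (card_config (r := s + 1) (a := k * (s + 1)) (by omega) hkr.le).1
    have : ((config (s + 1) (k * (s + 1))).card : ℤ) = ((3 * s ^ 2 + 3 * s + 1 + (s + 1) * k : ℕ) : ℤ) := by
      rw [h]; push_cast; ring
    exact_mod_cast this
  refine not_isUniqueUpToRigidMotion_of_card_filter_ne hc1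
    (by rw [card_config_erase (r := s + 1) (by omega) hk5, hc1]) hB.symm
    (by rw [adjCount_config_erase (r := s + 1) (by omega) hk1 hk5, hB]) 2 ?_
  rw [card_degree_two_config_mul (r := s + 1) hr hk1 hk5, card_degree_two_config_erase (r := s + 1) hr hk1 hk5]
  omega

/-- `N = 3s² + 3s + 1 + (s+1)k`, `s ≥ 2`, `1 ≤ k ≤ 5`, is not of the forms (a)/(b).
[cite: LucaFriesecke2017, Theorem 1.1 (p0003)] -/
theorem not_isUniqueParticleNumber_hexagonal_add_mul (s k : ℕ) (hs : 2 ≤ s) (hk1 : 1 ≤ k) (hk5 : k ≤ 5) :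
    ¬ IsUniqueParticleNumber (3 * s ^ 2 + 3 * s + 1 + (s + 1) * k) := by
  rintro (⟨u, hu⟩ | ⟨u, k', hk', hu⟩)
  · rcases le_or_gt u s with h | h
    · nlinarith
    · have h1 : s + 1 ≤ u := h
      nlinarith
  · rcases lt_trichotomy u s with h | rfl | h
    · have h1 : u + 1 ≤ s := h
      have : (u + 1) * k' ≤ (u + 1) * 4 := Nat.mul_le_mul_left (u + 1) hk'
      nlinarith
    · have h2 : (u + 1) * k = (u + 1) * k' + u := by omega
      interval_cases k <;> interval_cases k' <;> omega
    · have h1 : s + 1 ≤ u := h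
      nlinarith

/-! ## Local bookkeeping of degree counts (for further families)

Adding one label `x ∉ S` raises the number of neighbours of each neighbour of `x` by one and leaves all
other labels of `S` unchanged; so the number of `d`-valent labels changes only around `x`.  This lets a
successor compare the `d`-valent counts of two configurations differing by a few local moves without
computing either count globally. -/

/-- Inserting a label `x ∉ S`: a label `q` gains one neighbour if it touches `x` and none otherwise
(bookkeeping behind "moving a side leaves the energy unchanged"). [cite: LucaFriesecke2017, §2 (p0005)] -/
theorem card_filter_adj_insert_of_notMem {S : Finset (ℤ × ℤ)} {x : ℤ × ℤ} (hx : x ∉ S) (q : ℤ × ℤ) :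
    ((insert x S).filter (Adj q)).card = (S.filter (Adj q)).card + (if Adj q x then 1 else 0) := by
  classical
  rw [Finset.filter_insert]
  by_cases h : Adj q x
  · rw [if_pos h, if_pos h, Finset.card_insert_of_notMem (fun h' => hx (Finset.mem_filter.1 h').1)]
  · rw [if_neg h, if_neg h, add_zero]

/-- The inserted label itself has `#N_S(x)` neighbours. [cite: LucaFriesecke2017, §2 (p0005)] -/
theorem card_filter_adj_insert_self {S : Finset (ℤ × ℤ)} (x : ℤ × ℤ) :
    ((insert x S).filter (Adj x)).card = (S.filter (Adj x)).card := by
  rw [Finset.filter_insert, if_neg (not_adj_self x)]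

/-- **Local delta of degree counts under insertion.** For `x ∉ S` and any `d`, the number of `d`-valent
labels of `S ∪ {x}` equals: the `d`-valent labels of `S` not touching `x`, plus the `(d−1)`-valent labels of
`S` touching `x`, plus one if `x` itself has `d` neighbours.  (All other degrees are unchanged.)
[cite: LucaFriesecke2017, §2 (p0005)] -/
theorem card_filter_degree_insert {S : Finset (ℤ × ℤ)} {x : ℤ × ℤ} (hx : x ∉ S) (d : ℕ) :
    ((insert x S).filter fun q => ((insert x S).filter (Adj q)).card = d).card =
      ((S.filter fun q => ¬ Adj q x ∧ (S.filter (Adj q)).card = d).card +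
        (S.filter fun q => Adj q x ∧ (S.filter (Adj q)).card + 1 = d).card) +
        (if (S.filter (Adj x)).card = d then 1 else 0) := by
  classical
  -- split off `x`
  rw [Finset.filter_insert, card_filter_adj_insert_self]
  have hS : (S.filter fun q => ((insert x S).filter (Adj q)).card = d) =
      (S.filter fun q => ¬ Adj q x ∧ (S.filter (Adj q)).card = d) ∪
        (S.filter fun q => Adj q x ∧ (S.filter (Adj q)).card + 1 = d) := by
    ext q
    simp only [Finset.mem_filter, Finset.mem_union]
    constructor
    · rintro ⟨hq, hdeg⟩
      rw [card_filter_adj_insert_of_notMem hx q] at hdeg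
      by_cases h : Adj q x
      · rw [if_pos h] at hdeg; exact Or.inr ⟨hq, h, hdeg⟩
      · rw [if_neg h, add_zero] at hdeg; exact Or.inl ⟨hq, h, hdeg⟩
    · rintro (⟨hq, h, hdeg⟩ | ⟨hq, h, hdeg⟩)
      · exact ⟨hq, by rw [card_filter_adj_insert_of_notMem hx q, if_neg h, add_zero, hdeg]⟩
      · exact ⟨hq, by rw [card_filter_adj_insert_of_notMem hx q, if_pos h, hdeg]⟩
  have hdisj : Disjoint (S.filter fun q => ¬ Adj q x ∧ (S.filter (Adj q)).card = d)
      (S.filter fun q => Adj q x ∧ (S.filter (Adj q)).card + 1 = d) := by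
    rw [Finset.disjoint_filter]
    intro q _ h1 h2
    exact h1.1 h2.1
  split_ifs with hxd
  · rw [Finset.card_insert_of_notMem (fun h' => hx (Finset.mem_filter.1 h').1), hS,
      Finset.card_union_of_disjoint hdisj]
  · rw [hS, Finset.card_union_of_disjoint hdisj, add_zero]

/-- **Local delta under erasure**: `S = insert x (S ∖ x)`, so the `d`-valent counts of `S` and `S ∖ {x}`
differ only at the neighbours of `x` (read `card_filter_degree_insert` with `S ∖ {x}`).
[cite: LucaFriesecke2017, §2 (p0005)] -/
theorem card_filter_degree_erase {S : Finset (ℤ × ℤ)} {x : ℤ × ℤ} (hx : x ∈ S) (d : ℕ) :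
    (S.filter fun q => (S.filter (Adj q)).card = d).card =
      (((S.erase x).filter fun q => ¬ Adj q x ∧ ((S.erase x).filter (Adj q)).card = d).card +
        ((S.erase x).filter fun q => Adj q x ∧ ((S.erase x).filter (Adj q)).card + 1 = d).card) +
        (if ((S.erase x).filter (Adj x)).card = d then 1 else 0) := by
  have h := card_filter_degree_insert (Finset.notMem_erase x S) d
  rwa [Finset.insert_erase hx] at h

/-! ## A third infinite family: `N = 3s² + 3s + 1 + (s+1)k + j`, `1 ≤ j ≤ s − 2`, `k ≤ 3`, `s ≥ 3`

Harborth's `C₁ = config (s+1) a`, `a = k(s+1) + j`, ends strictly inside side `k + 1` of ring `s + 1`, at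
least two positions before its corner.  `C₃ := config (s+1) (a+1) ∖ {K₅}`, `K₅ = (−s, 0)` the corner of `H_s`
between sides `5` and `6` (untouched by the arc), has the same number of labels and contacts (the extra arc
label brings `3` contacts, the removed corner had `3`), and exactly ONE MORE `3`-valent label: by the local
bookkeeping lemmas, adding the arc label `a` turns the `3`-valent end label `a − 1` into a `4`-valent one and
is itself `3`-valent (its two inner neighbours are non-corner boundary labels of `H_s`, of valency `≥ 4`),
and removing `K₅` deletes one `3`-valent label and turns its two `4`-valent edge neighbours into `3`-valent
ones (its interior neighbour drops from `6` to `5`). -/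

section ThirdFamily

variable {r : ℕ}

/-- **A label of `H_{r−1}` other than its six corners has at least four neighbours in `H_{r−1}`**
(`r ≥ 2`). [cite: HeitmannRadin1980, §3 (p. 283)] -/
theorem four_le_card_filter_adj_hexagon {s : ℕ} (hs : 1 ≤ s) {q : ℤ × ℤ} (hq : q ∈ hexagon s)
    (hnc : ¬ (q = (-(s : ℤ), (s : ℤ)) ∨ q = (0, (s : ℤ)) ∨ q = ((s : ℤ), 0) ∨ q = ((s : ℤ), -(s : ℤ)) ∨
      q = (0, -(s : ℤ)) ∨ q = (-(s : ℤ), 0))) :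
    4 ≤ ((hexagon s).filter (Adj q)).card := by
  obtain ⟨m, n⟩ := q
  rw [mem_hexagon] at hq
  simp only [Inside] at hq
  simp only [Prod.mk.injEq] at hnc
  rw [card_filter_adj]
  simp only [ind, mem_hexagon, Inside]
  split_ifs <;> omega


variable {k j a : ℕ}

/-- A non-corner label of `H_{r−1}` has at least four neighbours in any spiral prefix `config r b` (`r ≥ 2`).
[cite: HeitmannRadin1980, §3 (p. 283)] -/
theorem four_le_card_filter_adj_config (hr : 2 ≤ r) (b : ℕ) {q : ℤ × ℤ} (hq : Inside ((r : ℤ) - 1) q)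
    (hnc : ¬ (q = (-((r : ℤ) - 1), (r : ℤ) - 1) ∨ q = (0, (r : ℤ) - 1) ∨ q = ((r : ℤ) - 1, 0) ∨
      q = ((r : ℤ) - 1, -((r : ℤ) - 1)) ∨ q = (0, -((r : ℤ) - 1)) ∨ q = (-((r : ℤ) - 1), 0))) :
    4 ≤ ((config r b).filter (Adj q)).card := by
  have hq' : q ∈ hexagon (r - 1) := (mem_hexagon_pred (by omega)).2 hq
  have e1 : ((r - 1 : ℕ) : ℤ) = (r : ℤ) - 1 := by rw [Nat.cast_sub (by omega : 1 ≤ r), Nat.cast_one]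
  have hnc' : ¬ (q = (-(((r - 1 : ℕ) : ℤ)), ((r - 1 : ℕ) : ℤ)) ∨ q = (0, ((r - 1 : ℕ) : ℤ)) ∨
      q = (((r - 1 : ℕ) : ℤ), 0) ∨ q = (((r - 1 : ℕ) : ℤ), -(((r - 1 : ℕ) : ℤ))) ∨ q = (0, -(((r - 1 : ℕ) : ℤ))) ∨
      q = (-(((r - 1 : ℕ) : ℤ)), 0)) := by
    rw [e1]; exact hnc
  have h4 := four_le_card_filter_adj_hexagon (s := r - 1) (by omega) hq' hnc'
  have hsub : hexagon (r - 1) ⊆ config r b := by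
    rw [← config_zero (by omega : 1 ≤ r)]; exact config_mono (Nat.zero_le b)
  exact h4.trans (Finset.card_le_card (Finset.filter_subset_filter _ hsub))

/-- **The two inner neighbours of the arc label at position `a = kr + j`, `1 ≤ j ≤ r − 3`, `k ≤ 3`:** two
distinct non-corner labels of `H_{r−1}` adjacent to `ringPoint r a` (charts A–E). [cite: Harborth1974, p. 15] -/
theorem exists_inner_nbrs (hr : 4 ≤ r) (hk : k ≤ 4) (hj1 : 1 ≤ j) (hj : j + 3 ≤ r) (ha : a = k * r + j) :
    ∃ e e' : ℤ × ℤ, e ≠ e' ∧ Inside ((r : ℤ) - 1) e ∧ Inside ((r : ℤ) - 1) e' ∧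
      Adj (ringPoint r a) e ∧ Adj (ringPoint r a) e' ∧
      ¬ (e = (-((r : ℤ) - 1), (r : ℤ) - 1) ∨ e = (0, (r : ℤ) - 1) ∨ e = ((r : ℤ) - 1, 0) ∨
        e = ((r : ℤ) - 1, -((r : ℤ) - 1)) ∨ e = (0, -((r : ℤ) - 1)) ∨ e = (-((r : ℤ) - 1), 0)) ∧
      ¬ (e' = (-((r : ℤ) - 1), (r : ℤ) - 1) ∨ e' = (0, (r : ℤ) - 1) ∨ e' = ((r : ℤ) - 1, 0) ∨
        e' = ((r : ℤ) - 1, -((r : ℤ) - 1)) ∨ e' = (0, -((r : ℤ) - 1)) ∨ e' = (-((r : ℤ) - 1), 0)) := by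
  interval_cases k
  · -- chart A: `ringPoint r a = (j − r + 1, r)`
    rw [ringPoint_A (r := (r : ℤ)) (a := (a : ℤ)) (by omega)]
    refine ⟨((j : ℤ) - r + 1, (r : ℤ) - 1), ((j : ℤ) - r + 2, (r : ℤ) - 1), ?_, ?_, ?_, ?_, ?_, ?_, ?_⟩ <;>
      simp only [ne_eq, Prod.mk.injEq, Inside, adj_iff_mem_nbrs, nbrs, Finset.mem_insert,
        Finset.mem_singleton, and_true] <;> omega
  · -- chart B: `ringPoint r a = (j + 1, r − 1 − j)`
    rw [ringPoint_B (r := (r : ℤ)) (a := (a : ℤ)) (by omega) (by omega)]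
    refine ⟨((j : ℤ), (r : ℤ) - 1 - j), ((j : ℤ) + 1, (r : ℤ) - 2 - j), ?_, ?_, ?_, ?_, ?_, ?_, ?_⟩ <;>
      simp only [ne_eq, Prod.mk.injEq, Inside, adj_iff_mem_nbrs, nbrs, Finset.mem_insert,
        Finset.mem_singleton] <;> omega
  · -- chart C: `ringPoint r a = (r, −1 − j)`
    rw [ringPoint_C (r := (r : ℤ)) (a := (a : ℤ)) (by omega) (by omega)]
    refine ⟨((r : ℤ) - 1, -1 - (j : ℤ)), ((r : ℤ) - 1, -(j : ℤ)), ?_, ?_, ?_, ?_, ?_, ?_, ?_⟩ <;>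
      simp only [ne_eq, Prod.mk.injEq, Inside, adj_iff_mem_nbrs, nbrs, Finset.mem_insert,
        Finset.mem_singleton, true_and] <;> omega
  · -- chart D: `ringPoint r a = (r − 1 − j, −r)`
    rw [ringPoint_D (r := (r : ℤ)) (a := (a : ℤ)) (by omega) (by omega)]
    refine ⟨((r : ℤ) - 1 - j, 1 - (r : ℤ)), ((r : ℤ) - 2 - j, 1 - (r : ℤ)), ?_, ?_, ?_, ?_, ?_, ?_, ?_⟩ <;>
      simp only [ne_eq, Prod.mk.injEq, Inside, adj_iff_mem_nbrs, nbrs, Finset.mem_insert,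
        Finset.mem_singleton, and_true] <;> omega
  · -- chart E: `ringPoint r a = (−1 − j, j + 1 − r)`
    rw [ringPoint_E (r := (r : ℤ)) (a := (a : ℤ)) (by omega) (by omega)]
    refine ⟨(-(j : ℤ), (j : ℤ) + 1 - r), (-1 - (j : ℤ), (j : ℤ) + 2 - r), ?_, ?_, ?_, ?_, ?_, ?_, ?_⟩ <;>
      simp only [ne_eq, Prod.mk.injEq, Inside, adj_iff_mem_nbrs, nbrs, Finset.mem_insert,
        Finset.mem_singleton] <;> omega

/-- `incr r a = 3` and `incr r (a − 1) = 3` for `a = kr + j`, `1 ≤ j ≤ r − 3` (`a ≥ 2` for the latter: the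
end of Harborth's arc and the label before it are interior to a side). [cite: Harborth1974, p. 15] -/
theorem incr_eq_three_of (hr : 4 ≤ r) (hk : k ≤ 4) (hj1 : 1 ≤ j) (hj : j + 3 ≤ r) (ha : a = k * r + j) :
    incr r a = 3 ∧ (2 ≤ a → incr r (a - 1) = 3) := by
  subst ha
  refine ⟨?_, fun h2 => ?_⟩
  · unfold incr
    interval_cases k <;> split_ifs <;> omega
  · unfold incr
    interval_cases k <;> split_ifs <;> omega

/-- **The neighbours of the arc label `a` inside `config r a`** are exactly its predecessor on the ring and
its two inner neighbours (`incr r a = 3`). [cite: Harborth1974, p. 15] -/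
theorem filter_adj_ringPoint_eq (hr : 4 ≤ r) (hk : k ≤ 4) (hj1 : 1 ≤ j) (hj : j + 3 ≤ r) (ha : a = k * r + j)
    (h2 : 2 ≤ a) {e e' : ℤ × ℤ} (hne : e ≠ e') (he : Inside ((r : ℤ) - 1) e) (he' : Inside ((r : ℤ) - 1) e')
    (hae : Adj (ringPoint r a) e) (hae' : Adj (ringPoint r a) e') :
    (config r a).filter (Adj (ringPoint r a)) =
      {ringPoint (r : ℤ) ((a - 1 : ℕ) : ℤ), e, e'} := by
  classical
  have hr1 : 1 ≤ r := by omega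
  have ha6 : a < 6 * r := by subst ha; nlinarith
  obtain ⟨m, hm⟩ : ∃ m : ℕ, a = m + 1 := ⟨a - 1, by omega⟩
  have hm' : a - 1 = m := by omega
  rw [hm']
  have hm6 : m + 1 < 6 * r := by omega
  -- the predecessor is a ring label, the inner neighbours are not
  obtain ⟨_, hring, -⟩ := ringPoint_spec (r := (r : ℤ)) (a := (m : ℤ)) (by exact_mod_cast hr1)
    (by positivity) (by omega)
  have hsub : ({ringPoint (r : ℤ) (m : ℤ), e, e'} : Finset (ℤ × ℤ)) ⊆ (config r a).filter (Adj (ringPoint r a)) := by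
    intro q hq
    simp only [Finset.mem_insert, Finset.mem_singleton] at hq
    rw [Finset.mem_filter]
    rcases hq with rfl | rfl | rfl
    · refine ⟨?_, ?_⟩
      · rw [hm, config_succ hr1 (by omega)]; exact Finset.mem_insert_self _ _
      · rw [adj_comm, hm]; exact adj_ringPoint_succ hr1 hm6
    · exact ⟨mem_config.2 (Or.inl he), hae⟩
    · exact ⟨mem_config.2 (Or.inl he'), hae'⟩
  have hcard3 : (({ringPoint (r : ℤ) (m : ℤ), e, e'} : Finset (ℤ × ℤ))).card = 3 := by
    rw [Finset.card_insert_of_notMem, Finset.card_pair hne]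
    simp only [Finset.mem_insert, Finset.mem_singleton, not_or]
    exact ⟨fun h => hring (h ▸ he), fun h => hring (h ▸ he')⟩
  have hcard : ((config r a).filter (Adj (ringPoint r a))).card = 3 := by
    have h := card_nbr_eq_incr (r := r) ha6
    rw [(incr_eq_three_of hr hk hj1 hj ha).1] at h
    exact_mod_cast h
  exact (Finset.eq_of_subset_of_card_le hsub (by rw [hcard, hcard3])).symm

/-- **Step A: adding the arc label `a` keeps the number of `3`-valent labels.**
`#₃(config r (a+1)) = #₃(config r a)` for `a = kr + j`, `1 ≤ j ≤ r − 3`, `k ≤ 3`, `a ≥ 2`.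
[cite: LucaFriesecke2017, §2 (p0005)] [cite: Harborth1974, p. 15] -/
theorem card_degree_three_config_succ (hr : 4 ≤ r) (hk : k ≤ 4) (hj1 : 1 ≤ j) (hj : j + 3 ≤ r)
    (ha : a = k * r + j) (h2 : 2 ≤ a) :
    ((config r (a + 1)).filter fun q => ((config r (a + 1)).filter (Adj q)).card = 3).card =
      ((config r a).filter fun q => ((config r a).filter (Adj q)).card = 3).card := by
  classical
  have hr1 : 1 ≤ r := by omega
  have ha6 : a < 6 * r := by subst ha; nlinarith
  have hx : ringPoint (r : ℤ) (a : ℤ) ∉ config r a := ringPoint_not_mem_config hr1 ha6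
  obtain ⟨e, e', hne, he, he', hae, hae', hce, hce'⟩ := exists_inner_nbrs hr hk hj1 hj ha
  have hN := filter_adj_ringPoint_eq hr hk hj1 hj ha h2 hne he he' hae hae'
  -- degrees in `config r a` of the three neighbours of `x`
  obtain ⟨m, hm⟩ : ∃ m : ℕ, a = m + 1 := ⟨a - 1, by omega⟩
  have hm' : a - 1 = m := by omega
  have hdeg_prev : ((config r a).filter (Adj (ringPoint (r : ℤ) (m : ℤ)))).card = 3 := by
    have h := card_filter_adj_config_last hr1 (p := m) (by omega)
    rw [← hm, (show incr r m = 3 by have := (incr_eq_three_of hr hk hj1 hj ha).2 h2; rwa [hm'] at this)] at h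
    exact_mod_cast h
  have hdeg_e : 4 ≤ ((config r a).filter (Adj e)).card := four_le_card_filter_adj_config (by omega) a he hce
  have hdeg_e' : 4 ≤ ((config r a).filter (Adj e')).card := four_le_card_filter_adj_config (by omega) a he' hce'
  -- who is adjacent to `x` in `config r a`
  have hadjx : ∀ q ∈ config r a, Adj q (ringPoint (r : ℤ) (a : ℤ)) → q = ringPoint (r : ℤ) (m : ℤ) ∨ q = e ∨ q = e' := by
    intro q hq hqx
    have : q ∈ (config r a).filter (Adj (ringPoint r a)) := Finset.mem_filter.2 ⟨hq, (adj_comm _ _).1 hqx⟩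
    rw [hN, hm'] at this
    simpa only [Finset.mem_insert, Finset.mem_singleton] using this
  rw [config_succ hr1 ha6, card_filter_degree_insert hx 3]
  -- the inserted label has `incr r a = 3` neighbours
  have hxdeg : ((config r a).filter (Adj (ringPoint (r : ℤ) (a : ℤ)))).card = 3 := by
    have h := card_nbr_eq_incr (r := r) ha6
    rw [(incr_eq_three_of hr hk hj1 hj ha).1] at h
    exact_mod_cast h
  rw [if_pos hxdeg]
  -- no neighbour of `x` has exactly two neighbours
  have h0 : ((config r a).filter fun q => Adj q (ringPoint (r : ℤ) (a : ℤ)) ∧ ((config r a).filter (Adj q)).card + 1 = 3).card = 0 := by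
    rw [Finset.card_eq_zero, Finset.filter_eq_empty_iff]
    rintro q hq ⟨hqx, hdeg⟩
    rcases hadjx q hq hqx with rfl | rfl | rfl <;> omega
  -- exactly one neighbour of `x` (its predecessor) has three neighbours
  have h1 : ((config r a).filter fun q => Adj q (ringPoint (r : ℤ) (a : ℤ)) ∧ ((config r a).filter (Adj q)).card = 3).card = 1 := by
    rw [Finset.card_eq_one]
    refine ⟨ringPoint (r : ℤ) (m : ℤ), ?_⟩
    ext q
    simp only [Finset.mem_filter, Finset.mem_singleton]
    constructor
    · rintro ⟨hq, hqx, hdeg⟩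
      rcases hadjx q hq hqx with rfl | rfl | rfl
      · rfl
      · omega
      · omega
    · rintro rfl
      refine ⟨?_, ?_, hdeg_prev⟩
      · rw [hm, config_succ hr1 (by omega)]; exact Finset.mem_insert_self _ _
      · rw [hm]; exact adj_ringPoint_succ hr1 (by omega)
  -- split the `3`-valent labels of `config r a` by adjacency to `x`
  have hsplit : ((config r a).filter fun q => ((config r a).filter (Adj q)).card = 3).card =
      ((config r a).filter fun q => ¬ Adj q (ringPoint (r : ℤ) (a : ℤ)) ∧ ((config r a).filter (Adj q)).card = 3).card +
        ((config r a).filter fun q => Adj q (ringPoint (r : ℤ) (a : ℤ)) ∧ ((config r a).filter (Adj q)).card = 3).card := by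
    rw [← Finset.card_union_of_disjoint]
    · congr 1
      ext q
      simp only [Finset.mem_filter, Finset.mem_union]
      by_cases h : Adj q (ringPoint (r : ℤ) (a : ℤ)) <;> simp [h]
    · rw [Finset.disjoint_filter]
      intro q _ h1 h2
      exact h1.1 h2.1
  rw [hsplit, h0, h1]

/-- The corner `K₅ = (1 − r, 0)` of `H_{r−1}` has exactly three neighbours in `config r b` for
`b ≤ 5r − 2` (its three outer positions `5r−2, 5r−1, 5r` are empty), namely `(2−r, 0)`, `(1−r, 1)`,
`(2−r, −1)` (`r ≥ 3`). [cite: Harborth1974, p. 15] -/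
theorem filter_adj_corner_five (hr : 3 ≤ r) {b : ℕ} (hb : b + 2 ≤ 5 * r) :
    (config r b).filter (Adj ((1 : ℤ) - r, 0)) =
      {((2 : ℤ) - r, 0), ((1 : ℤ) - r, 1), ((2 : ℤ) - r, -1)} := by
  classical
  -- membership of the six lattice neighbours of `K₅` in `config r b`
  have hin : ∀ m n : ℤ, Inside ((r : ℤ) - 1) (m, n) → ((m, n) : ℤ × ℤ) ∈ config r b := fun m n h =>
    mem_config.2 (Or.inl h)
  have h1 : (((1 : ℤ) - r + 1, (0 : ℤ)) : ℤ × ℤ) ∈ config r b := hin _ _ (by simp only [Inside]; omega)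
  have h1' : (((2 : ℤ) - r, (0 : ℤ)) : ℤ × ℤ) ∈ config r b := hin _ _ (by simp only [Inside]; omega)
  have h3 : (((1 : ℤ) - r, (1 : ℤ)) : ℤ × ℤ) ∈ config r b := hin _ _ (by simp only [Inside]; omega)
  have h5 : (((1 : ℤ) - r + 1, (-1 : ℤ)) : ℤ × ℤ) ∈ config r b := hin _ _ (by simp only [Inside]; omega)
  have h5' : (((2 : ℤ) - r, (-1 : ℤ)) : ℤ × ℤ) ∈ config r b := hin _ _ (by simp only [Inside]; omega)
  -- the three outer neighbours sit on ring `r` at positions `5r − 2, 5r − 1, 5r`, which are empty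
  have hpos : ∀ m n : ℤ, (m = -r ∧ n = 0) ∨ (m = 1 - r ∧ n = -1) ∨ (m = -r ∧ n = 1) →
      5 * (r : ℤ) - 2 ≤ pos r (m, n) := by
    intro m n h
    generalize hP : pos (r : ℤ) (m, n) = P
    simp only [pos] at hP
    split_ifs at hP <;> omega
  have hout : ∀ m n : ℤ, (m = -r ∧ n = 0) ∨ (m = 1 - r ∧ n = -1) ∨ (m = -r ∧ n = 1) →
      ((m, n) : ℤ × ℤ) ∉ config r b := by
    intro m n h hmem
    have hp := hpos m n h
    rcases mem_config.1 hmem with h'' | ⟨-, h''⟩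
    · simp only [Inside] at h''; omega
    · omega
  have h2 : (((1 : ℤ) - r - 1, (0 : ℤ)) : ℤ × ℤ) ∉ config r b := hout _ _ (Or.inl ⟨by ring, rfl⟩)
  have h4 : (((1 : ℤ) - r, (-1 : ℤ)) : ℤ × ℤ) ∉ config r b := hout _ _ (Or.inr (Or.inl ⟨rfl, rfl⟩))
  have h6 : (((1 : ℤ) - r - 1, (1 : ℤ)) : ℤ × ℤ) ∉ config r b := hout _ _ (Or.inr (Or.inr ⟨by ring, rfl⟩))
  ext ⟨m, n⟩
  simp only [Finset.mem_filter, adj_iff_mem_nbrs, nbrs, Finset.mem_insert, Finset.mem_singleton, Prod.mk.injEq]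
  constructor
  · rintro ⟨hmem, hadj⟩
    rcases hadj with ⟨rfl, rfl⟩ | ⟨rfl, rfl⟩ | ⟨rfl, rfl⟩ | ⟨rfl, rfl⟩ | ⟨rfl, rfl⟩ | ⟨rfl, rfl⟩
    · left; constructor <;> omega
    · exact absurd hmem h2
    · right; left; constructor <;> omega
    · exact absurd hmem h4
    · right; right; constructor <;> omega
    · exact absurd hmem h6
  · rintro (⟨rfl, rfl⟩ | ⟨rfl, rfl⟩ | ⟨rfl, rfl⟩)
    · exact ⟨h1', by omega⟩
    · exact ⟨h3, by omega⟩
    · exact ⟨h5', by omega⟩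

/-- Membership of an explicit label in `config r b ∖ {K₅}`, reduced to linear arithmetic: the label is
not `K₅`, and lies in `H_{r−1}` or on ring `r` at a position `< b`. (Helper for the degree computations
around `K₅`.) [cite: Harborth1974, p. 15] -/
private theorem card_filter_adj_erase_corner_five (hr : 4 ≤ r) {b : ℕ} (hb : b + 3 ≤ 5 * r) (hb1 : 1 ≤ b) :
    (((config r b).erase ((1 : ℤ) - r, 0)).filter (Adj ((1 : ℤ) - r, 1))).card = 3 ∧
    (((config r b).erase ((1 : ℤ) - r, 0)).filter (Adj ((2 : ℤ) - r, -1))).card = 3 ∧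
    (((config r b).erase ((1 : ℤ) - r, 0)).filter (Adj ((2 : ℤ) - r, 0))).card = 5 := by
  refine ⟨?_, ?_, ?_⟩ <;>
  · rw [card_filter_adj]
    simp only [ind, Finset.mem_erase, mem_config, Inside, ne_eq, Prod.mk.injEq, pos]
    push_cast
    simp (disch := omega) only [if_pos, if_neg, ite_false, and_true, true_and, and_false,
      false_and, not_true_eq_false, not_false_eq_true]

/-- **Step B: removing the corner `K₅` from `config r b` (`2 ≤ b ≤ 5r − 2`, `r ≥ 4`) adds exactly one
`3`-valent label.** [cite: LucaFriesecke2017, §2 (p0005)] -/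
theorem card_degree_three_erase_corner_five (hr : 4 ≤ r) {b : ℕ} (hb : b + 3 ≤ 5 * r) (hb1 : 1 ≤ b) :
    (((config r b).erase ((1 : ℤ) - r, 0)).filter fun q =>
        (((config r b).erase ((1 : ℤ) - r, 0)).filter (Adj q)).card = 3).card =
      ((config r b).filter fun q => ((config r b).filter (Adj q)).card = 3).card + 1 := by
  classical
  set K : ℤ × ℤ := ((1 : ℤ) - r, 0) with hKdef
  set C := (config r b).erase K with hC
  have hKmem : K ∈ config r b := mem_config.2 (Or.inl (by simp only [hKdef, Inside]; omega))
  obtain ⟨hu, hv, hi⟩ := card_filter_adj_erase_corner_five hr hb hb1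
  rw [← hKdef, ← hC] at hu hv hi
  -- the neighbours of `K` in `C`
  have hNK : C.filter (Adj K) = {((2 : ℤ) - r, 0), ((1 : ℤ) - r, 1), ((2 : ℤ) - r, -1)} := by
    rw [hC, Finset.filter_erase, filter_adj_corner_five (by omega) (by omega), Finset.erase_eq_of_notMem]
    simp only [hKdef, Finset.mem_insert, Finset.mem_singleton, Prod.mk.injEq, not_or]
    refine ⟨by omega, by omega, by omega⟩
  have hNK3 : (C.filter (Adj K)).card = 3 := by
    rw [hNK, Finset.card_insert_of_notMem, Finset.card_pair]
    · simp only [ne_eq, Prod.mk.injEq, not_and]; omega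
    · simp only [Finset.mem_insert, Finset.mem_singleton, Prod.mk.injEq, not_or]; omega
  have hadjK : ∀ q ∈ C, Adj q K → q = ((2 : ℤ) - r, 0) ∨ q = ((1 : ℤ) - r, 1) ∨ q = ((2 : ℤ) - r, -1) := by
    intro q hq hqK
    have : q ∈ C.filter (Adj K) := Finset.mem_filter.2 ⟨hq, (adj_comm _ _).1 hqK⟩
    rw [hNK] at this
    simpa only [Finset.mem_insert, Finset.mem_singleton] using this
  have hmemC : ∀ q : ℤ × ℤ, q = ((2 : ℤ) - r, 0) ∨ q = ((1 : ℤ) - r, 1) ∨ q = ((2 : ℤ) - r, -1) → q ∈ C ∧ Adj q K := by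
    intro q hq
    have : q ∈ C.filter (Adj K) := by
      rw [hNK]; simpa only [Finset.mem_insert, Finset.mem_singleton] using hq
    exact ⟨(Finset.mem_filter.1 this).1, (adj_comm _ _).1 (Finset.mem_filter.1 this).2⟩
  -- Step B bookkeeping
  have hB := card_filter_degree_erase hKmem 3
  rw [← hC] at hB
  rw [if_pos hNK3] at hB
  -- among the neighbours of `K`: none is `2`-valent in `C`, two are `3`-valent
  have h0 : (C.filter fun q => Adj q K ∧ (C.filter (Adj q)).card + 1 = 3).card = 0 := by
    rw [Finset.card_eq_zero, Finset.filter_eq_empty_iff]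
    rintro q hq ⟨hqK, hdeg⟩
    rcases hadjK q hq hqK with rfl | rfl | rfl <;> omega
  have h2 : (C.filter fun q => Adj q K ∧ (C.filter (Adj q)).card = 3).card = 2 := by
    have : (C.filter fun q => Adj q K ∧ (C.filter (Adj q)).card = 3) = {((1 : ℤ) - r, 1), ((2 : ℤ) - r, -1)} := by
      ext q
      simp only [Finset.mem_filter, Finset.mem_insert, Finset.mem_singleton]
      constructor
      · rintro ⟨hq, hqK, hdeg⟩
        rcases hadjK q hq hqK with rfl | rfl | rfl
        · omega
        · exact Or.inl rfl
        · exact Or.inr rfl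
      · rintro (rfl | rfl)
        · exact ⟨(hmemC _ (Or.inr (Or.inl rfl))).1, (hmemC _ (Or.inr (Or.inl rfl))).2, hu⟩
        · exact ⟨(hmemC _ (Or.inr (Or.inr rfl))).1, (hmemC _ (Or.inr (Or.inr rfl))).2, hv⟩
    rw [this, Finset.card_pair]
    simp only [ne_eq, Prod.mk.injEq, not_and]; omega
  have hsplit : (C.filter fun q => (C.filter (Adj q)).card = 3).card =
      (C.filter fun q => ¬ Adj q K ∧ (C.filter (Adj q)).card = 3).card +
        (C.filter fun q => Adj q K ∧ (C.filter (Adj q)).card = 3).card := by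
    rw [← Finset.card_union_of_disjoint]
    · congr 1
      ext q
      simp only [Finset.mem_filter, Finset.mem_union]
      by_cases h : Adj q K <;> simp [h]
    · rw [Finset.disjoint_filter]
      intro q _ h1 h2
      exact h1.1 h2.1
  rw [hsplit, h2]
  omega

/-- `adjCount` and cardinality of `C₃ = config r (a+1) ∖ {K₅}` versus `C₁ = config r a`.
[cite: LucaFriesecke2017, §2 (p0005)] [cite: Harborth1974, p. 15] -/
theorem adjCount_config_succ_erase_corner_five (hr : 4 ≤ r) (hk : k ≤ 4) (hj1 : 1 ≤ j) (hj : j + 3 ≤ r)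
    (ha : a = k * r + j) :
    adjCount ((config r (a + 1)).erase ((1 : ℤ) - r, 0)) = adjCount (config r a) ∧
      ((config r (a + 1)).erase ((1 : ℤ) - r, 0)).card = (config r a).card := by
  classical
  have hr1 : 1 ≤ r := by omega
  have ha6 : a < 6 * r := by subst ha; nlinarith
  have hb : a + 1 + 2 ≤ 5 * r := by subst ha; nlinarith
  have hKmem : (((1 : ℤ) - r, 0) : ℤ × ℤ) ∈ config r (a + 1) :=
    mem_config.2 (Or.inl (by simp only [Inside]; omega))
  refine ⟨?_, ?_⟩
  · have h1 := adjCount_eq_erase_add hKmem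
    have h2 : (((config r (a + 1)).erase ((1 : ℤ) - r, 0)).filter (Adj ((1 : ℤ) - r, 0))).card = 3 := by
      rw [Finset.filter_erase, filter_adj_corner_five (by omega) hb, Finset.erase_eq_of_notMem]
      · rw [Finset.card_insert_of_notMem, Finset.card_pair]
        · simp only [ne_eq, Prod.mk.injEq, not_and]; omega
        · simp only [Finset.mem_insert, Finset.mem_singleton, Prod.mk.injEq, not_or]; omega
      · simp only [Finset.mem_insert, Finset.mem_singleton, Prod.mk.injEq, not_or]; omega
    have h4 := card_nbr_eq_incr (r := r) ha6
    rw [(incr_eq_three_of hr hk hj1 hj ha).1] at h4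
    have h3 : (adjCount (config r (a + 1)) : ℤ) = adjCount (config r a) + 2 * 3 := by
      rw [config_succ hr1 ha6, adjCount_insert (ringPoint_not_mem_config hr1 ha6), Nat.cast_add, Nat.cast_mul,
        h4, Nat.cast_ofNat]
    rw [h2] at h1
    omega
  · rw [Finset.card_erase_of_mem hKmem, config_succ hr1 ha6,
      Finset.card_insert_of_notMem (ringPoint_not_mem_config hr1 ha6)]
    rfl

end ThirdFamily

/-- **For every `s ≥ 3`, `k ≤ 4` and `1 ≤ j ≤ s − 2` (`j ≤ s − 3` if `k = 4`; `(k, j) ≠ (0, 1)`) the ground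
state of `N = 3s² + 3s + 1 + (s+1)k + j` sticky discs is NOT unique up to rotation and translation**: Harborth's
spiral configuration and the configuration "one more arc label, corner `K₅` of the hexagon removed" are
maximal with different numbers of `3`-valent discs. [cite: LucaFriesecke2017, Theorem 1.1 and §2 (p0003, p0005)] -/
theorem not_isUniqueUpToRigidMotion_hexagonal_add_mul_add (s k j : ℕ) (hs : 3 ≤ s) (hk : k ≤ 4)
    (hj1 : 1 ≤ j) (hj : j + 2 ≤ s) (hkj : k ≠ 0 ∨ 2 ≤ j) (hk4 : k ≤ 3 ∨ j + 3 ≤ s) :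
    ¬ IsUniqueUpToRigidMotion (3 * s ^ 2 + 3 * s + 1 + (s + 1) * k + j) := by
  have hr : 4 ≤ s + 1 := by omega
  obtain ⟨a, ha⟩ : ∃ a : ℕ, a = k * (s + 1) + j := ⟨_, rfl⟩
  have ha2 : 2 ≤ a := by
    rcases hkj with hk0 | hj2
    · have : 1 ≤ k := Nat.one_le_iff_ne_zero.2 hk0
      nlinarith
    · omega
  have ha6 : a < 6 * (s + 1) := by nlinarith
  have hN : ((3 * s ^ 2 + 3 * s + 1 + (s + 1) * k + j : ℕ) : ℤ) =
      3 * ((s + 1 : ℕ) : ℤ) ^ 2 - 3 * ((s + 1 : ℕ) : ℤ) + 1 + (a : ℤ) := by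
    rw [ha]; push_cast; ring
  have hB := two_mul_harborthNumber_eq_adjCount_config (r := s + 1) (a := a) (by omega) ha6 hN
  have hc1 : (config (s + 1) a).card = 3 * s ^ 2 + 3 * s + 1 + (s + 1) * k + j := by
    have h := (card_config (r := s + 1) (a := a) (by omega) ha6.le).1
    have : ((config (s + 1) a).card : ℤ) = ((3 * s ^ 2 + 3 * s + 1 + (s + 1) * k + j : ℕ) : ℤ) := by
      rw [h, ha]; push_cast; ring
    exact_mod_cast this
  obtain ⟨hadj, hcard⟩ := adjCount_config_succ_erase_corner_five (r := s + 1) hr hk hj1 (by omega) ha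
  refine not_isUniqueUpToRigidMotion_of_card_filter_ne hc1 (by rw [hcard, hc1]) hB.symm (by rw [hadj, hB]) 3 ?_
  have hb3 : a + 1 + 3 ≤ 5 * (s + 1) := by
    rcases hk4 with h3 | h3
    · nlinarith
    · nlinarith
  rw [card_degree_three_erase_corner_five (r := s + 1) hr hb3 (by omega),
    card_degree_three_config_succ (r := s + 1) hr hk hj1 (by omega) ha ha2]
  omega


/-! ## The remaining particle numbers with `s = 1`: `N = 11, 13, 15, 17, 18` (Theorem 1.1 for `N ≤ 21`) -/

/-- **`N = 11`**: Harborth's `config 2 4` and a second maximal configuration with `21` contacts differ in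
their number of `5`-valent discs. [cite: LucaFriesecke2017, Theorem 1.1 and §2 (p0003, p0005)] -/
theorem not_isUniqueUpToRigidMotion_eleven : ¬ IsUniqueUpToRigidMotion 11 := by
  have hB : 2 * harborthNumber 11 = adjCount (config 2 4) :=
    two_mul_harborthNumber_eq_adjCount_config (r := 2) (a := 4) (by norm_num) (by norm_num) (by norm_num)
  have hc : adjCount (config 2 4) = 42 := by decide +kernel
  have hc2 : adjCount ({((-2 : ℤ), (0 : ℤ)), ((-2 : ℤ), (1 : ℤ)), ((-1 : ℤ), (-1 : ℤ)), ((-1 : ℤ), (0 : ℤ)), ((-1 : ℤ), (1 : ℤ)), ((0 : ℤ), (-1 : ℤ)), ((0 : ℤ), (0 : ℤ)), ((0 : ℤ), (1 : ℤ)), ((1 : ℤ), (-1 : ℤ)), ((1 : ℤ), (0 : ℤ)), ((1 : ℤ), (1 : ℤ))} : Finset (ℤ × ℤ)) = 42 := by decide +kernel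
  refine not_isUniqueUpToRigidMotion_of_card_filter_ne (S₁ := config 2 4)
    (S₂ := {((-2 : ℤ), (0 : ℤ)), ((-2 : ℤ), (1 : ℤ)), ((-1 : ℤ), (-1 : ℤ)), ((-1 : ℤ), (0 : ℤ)), ((-1 : ℤ), (1 : ℤ)), ((0 : ℤ), (-1 : ℤ)), ((0 : ℤ), (0 : ℤ)), ((0 : ℤ), (1 : ℤ)), ((1 : ℤ), (-1 : ℤ)), ((1 : ℤ), (0 : ℤ)), ((1 : ℤ), (1 : ℤ))})
    (by decide +kernel) (by decide +kernel) hB.symm (by rw [hB, hc, hc2]) 5 ?_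
  decide +kernel

/-- **`N = 13`**: Harborth's `config 2 6` and a second maximal configuration with `26` contacts differ in
their number of `5`-valent discs. [cite: LucaFriesecke2017, Theorem 1.1 and §2 (p0003, p0005)] -/
theorem not_isUniqueUpToRigidMotion_thirteen : ¬ IsUniqueUpToRigidMotion 13 := by
  have hB : 2 * harborthNumber 13 = adjCount (config 2 6) :=
    two_mul_harborthNumber_eq_adjCount_config (r := 2) (a := 6) (by norm_num) (by norm_num) (by norm_num)
  have hc : adjCount (config 2 6) = 52 := by decide +kernel
  have hc2 : adjCount ({((-2 : ℤ), (0 : ℤ)), ((-2 : ℤ), (1 : ℤ)), ((-2 : ℤ), (2 : ℤ)), ((-1 : ℤ), (-1 : ℤ)), ((-1 : ℤ), (0 : ℤ)), ((-1 : ℤ), (1 : ℤ)), ((-1 : ℤ), (2 : ℤ)), ((0 : ℤ), (-1 : ℤ)), ((0 : ℤ), (0 : ℤ)), ((0 : ℤ), (1 : ℤ)), ((1 : ℤ), (-1 : ℤ)), ((1 : ℤ), (0 : ℤ)), ((2 : ℤ), (-1 : ℤ))} : Finset (ℤ × ℤ)) = 52 := by decide +kernel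
  refine not_isUniqueUpToRigidMotion_of_card_filter_ne (S₁ := config 2 6)
    (S₂ := {((-2 : ℤ), (0 : ℤ)), ((-2 : ℤ), (1 : ℤ)), ((-2 : ℤ), (2 : ℤ)), ((-1 : ℤ), (-1 : ℤ)), ((-1 : ℤ), (0 : ℤ)), ((-1 : ℤ), (1 : ℤ)), ((-1 : ℤ), (2 : ℤ)), ((0 : ℤ), (-1 : ℤ)), ((0 : ℤ), (0 : ℤ)), ((0 : ℤ), (1 : ℤ)), ((1 : ℤ), (-1 : ℤ)), ((1 : ℤ), (0 : ℤ)), ((2 : ℤ), (-1 : ℤ))})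
    (by decide +kernel) (by decide +kernel) hB.symm (by rw [hB, hc, hc2]) 5 ?_
  decide +kernel

/-- **`N = 15`**: Harborth's `config 2 8` and a second maximal configuration with `31` contacts differ in
their number of `2`-valent discs. [cite: LucaFriesecke2017, Theorem 1.1 and §2 (p0003, p0005)] -/
theorem not_isUniqueUpToRigidMotion_fifteen : ¬ IsUniqueUpToRigidMotion 15 := by
  have hB : 2 * harborthNumber 15 = adjCount (config 2 8) :=
    two_mul_harborthNumber_eq_adjCount_config (r := 2) (a := 8) (by norm_num) (by norm_num) (by norm_num)
  have hc : adjCount (config 2 8) = 62 := by decide +kernel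
  have hc2 : adjCount ({((-2 : ℤ), (0 : ℤ)), ((-2 : ℤ), (1 : ℤ)), ((-2 : ℤ), (2 : ℤ)), ((-1 : ℤ), (-1 : ℤ)), ((-1 : ℤ), (0 : ℤ)), ((-1 : ℤ), (1 : ℤ)), ((-1 : ℤ), (2 : ℤ)), ((0 : ℤ), (-1 : ℤ)), ((0 : ℤ), (0 : ℤ)), ((0 : ℤ), (1 : ℤ)), ((1 : ℤ), (-2 : ℤ)), ((1 : ℤ), (-1 : ℤ)), ((1 : ℤ), (0 : ℤ)), ((2 : ℤ), (-2 : ℤ)), ((2 : ℤ), (-1 : ℤ))} : Finset (ℤ × ℤ)) = 62 := by decide +kernel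
  refine not_isUniqueUpToRigidMotion_of_card_filter_ne (S₁ := config 2 8)
    (S₂ := {((-2 : ℤ), (0 : ℤ)), ((-2 : ℤ), (1 : ℤ)), ((-2 : ℤ), (2 : ℤ)), ((-1 : ℤ), (-1 : ℤ)), ((-1 : ℤ), (0 : ℤ)), ((-1 : ℤ), (1 : ℤ)), ((-1 : ℤ), (2 : ℤ)), ((0 : ℤ), (-1 : ℤ)), ((0 : ℤ), (0 : ℤ)), ((0 : ℤ), (1 : ℤ)), ((1 : ℤ), (-2 : ℤ)), ((1 : ℤ), (-1 : ℤ)), ((1 : ℤ), (0 : ℤ)), ((2 : ℤ), (-2 : ℤ)), ((2 : ℤ), (-1 : ℤ))})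
    (by decide +kernel) (by decide +kernel) hB.symm (by rw [hB, hc, hc2]) 2 ?_
  decide +kernel

/-- **`N = 17`**: Harborth's `config 2 10` and a second maximal configuration with `36` contacts differ in
their number of `4`-valent discs. [cite: LucaFriesecke2017, Theorem 1.1 and §2 (p0003, p0005)] -/
theorem not_isUniqueUpToRigidMotion_seventeen : ¬ IsUniqueUpToRigidMotion 17 := by
  have hB : 2 * harborthNumber 17 = adjCount (config 2 10) :=
    two_mul_harborthNumber_eq_adjCount_config (r := 2) (a := 10) (by norm_num) (by norm_num) (by norm_num)
  have hc : adjCount (config 2 10) = 72 := by decide +kernel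
  have hc2 : adjCount ({((-2 : ℤ), (0 : ℤ)), ((-2 : ℤ), (1 : ℤ)), ((-2 : ℤ), (2 : ℤ)), ((-1 : ℤ), (-1 : ℤ)), ((-1 : ℤ), (0 : ℤ)), ((-1 : ℤ), (1 : ℤ)), ((-1 : ℤ), (2 : ℤ)), ((0 : ℤ), (-2 : ℤ)), ((0 : ℤ), (-1 : ℤ)), ((0 : ℤ), (0 : ℤ)), ((0 : ℤ), (1 : ℤ)), ((0 : ℤ), (2 : ℤ)), ((1 : ℤ), (-2 : ℤ)), ((1 : ℤ), (-1 : ℤ)), ((1 : ℤ), (0 : ℤ)), ((1 : ℤ), (1 : ℤ)), ((2 : ℤ), (-1 : ℤ))} : Finset (ℤ × ℤ)) = 72 := by decide +kernel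
  refine not_isUniqueUpToRigidMotion_of_card_filter_ne (S₁ := config 2 10)
    (S₂ := {((-2 : ℤ), (0 : ℤ)), ((-2 : ℤ), (1 : ℤ)), ((-2 : ℤ), (2 : ℤ)), ((-1 : ℤ), (-1 : ℤ)), ((-1 : ℤ), (0 : ℤ)), ((-1 : ℤ), (1 : ℤ)), ((-1 : ℤ), (2 : ℤ)), ((0 : ℤ), (-2 : ℤ)), ((0 : ℤ), (-1 : ℤ)), ((0 : ℤ), (0 : ℤ)), ((0 : ℤ), (1 : ℤ)), ((0 : ℤ), (2 : ℤ)), ((1 : ℤ), (-2 : ℤ)), ((1 : ℤ), (-1 : ℤ)), ((1 : ℤ), (0 : ℤ)), ((1 : ℤ), (1 : ℤ)), ((2 : ℤ), (-1 : ℤ))})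
    (by decide +kernel) (by decide +kernel) hB.symm (by rw [hB, hc, hc2]) 4 ?_
  decide +kernel

/-- **`N = 18`**: Harborth's `config 2 11` and a second maximal configuration with `39` contacts differ in
their number of `5`-valent discs. [cite: LucaFriesecke2017, Theorem 1.1 and §2 (p0003, p0005)] -/
theorem not_isUniqueUpToRigidMotion_eighteen : ¬ IsUniqueUpToRigidMotion 18 := by
  have hB : 2 * harborthNumber 18 = adjCount (config 2 11) :=
    two_mul_harborthNumber_eq_adjCount_config (r := 2) (a := 11) (by norm_num) (by norm_num) (by norm_num)
  have hc : adjCount (config 2 11) = 78 := by decide +kernel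
  have hc2 : adjCount ({((-3 : ℤ), (1 : ℤ)), ((-3 : ℤ), (2 : ℤ)), ((-2 : ℤ), (0 : ℤ)), ((-2 : ℤ), (1 : ℤ)), ((-2 : ℤ), (2 : ℤ)), ((-1 : ℤ), (-1 : ℤ)), ((-1 : ℤ), (0 : ℤ)), ((-1 : ℤ), (1 : ℤ)), ((-1 : ℤ), (2 : ℤ)), ((0 : ℤ), (-2 : ℤ)), ((0 : ℤ), (-1 : ℤ)), ((0 : ℤ), (0 : ℤ)), ((0 : ℤ), (1 : ℤ)), ((0 : ℤ), (2 : ℤ)), ((1 : ℤ), (-2 : ℤ)), ((1 : ℤ), (-1 : ℤ)), ((1 : ℤ), (0 : ℤ)), ((1 : ℤ), (1 : ℤ))} : Finset (ℤ × ℤ)) = 78 := by decide +kernel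
  refine not_isUniqueUpToRigidMotion_of_card_filter_ne (S₁ := config 2 11)
    (S₂ := {((-3 : ℤ), (1 : ℤ)), ((-3 : ℤ), (2 : ℤ)), ((-2 : ℤ), (0 : ℤ)), ((-2 : ℤ), (1 : ℤ)), ((-2 : ℤ), (2 : ℤ)), ((-1 : ℤ), (-1 : ℤ)), ((-1 : ℤ), (0 : ℤ)), ((-1 : ℤ), (1 : ℤ)), ((-1 : ℤ), (2 : ℤ)), ((0 : ℤ), (-2 : ℤ)), ((0 : ℤ), (-1 : ℤ)), ((0 : ℤ), (0 : ℤ)), ((0 : ℤ), (1 : ℤ)), ((0 : ℤ), (2 : ℤ)), ((1 : ℤ), (-2 : ℤ)), ((1 : ℤ), (-1 : ℤ)), ((1 : ℤ), (0 : ℤ)), ((1 : ℤ), (1 : ℤ))})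
    (by decide +kernel) (by decide +kernel) hB.symm (by rw [hB, hc, hc2]) 5 ?_
  decide +kernel

/-- **De Luca–Friesecke's Theorem 1.1 holds for `N ≤ 21`**: among `1 ≤ N ≤ 21` the minimizer is unique up
to rotation and translation exactly for `N ∈ {1, 2, 3, 4, 5, 7, 8, 10, 12, 14, 16, 19, 21}`.
[cite: LucaFriesecke2017, Theorem 1.1 (p0003)] -/
theorem uniqueness_iff_of_le_twentyone {N : ℕ} (h1 : 1 ≤ N) (h21 : N ≤ 21) :
    IsUniqueUpToRigidMotion N ↔ IsUniqueParticleNumber N := by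
  refine ⟨fun hU => ?_, isUniqueUpToRigidMotion_of_isUniqueParticleNumber⟩
  interval_cases N
  · exact Or.inl ⟨0, by norm_num⟩
  · exact Or.inr ⟨0, 1, by norm_num, by norm_num⟩
  · exact Or.inr ⟨0, 2, by norm_num, by norm_num⟩
  · exact Or.inr ⟨0, 3, by norm_num, by norm_num⟩
  · exact Or.inr ⟨0, 4, by norm_num, by norm_num⟩
  · exact absurd hU not_isUniqueUpToRigidMotion_six
  · exact Or.inl ⟨1, by norm_num⟩
  · exact Or.inr ⟨1, 0, by norm_num, by norm_num⟩
  · exact absurd hU not_isUniqueUpToRigidMotion_nine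
  · exact Or.inr ⟨1, 1, by norm_num, by norm_num⟩
  · exact absurd hU not_isUniqueUpToRigidMotion_eleven
  · exact Or.inr ⟨1, 2, by norm_num, by norm_num⟩
  · exact absurd hU not_isUniqueUpToRigidMotion_thirteen
  · exact Or.inr ⟨1, 3, by norm_num, by norm_num⟩
  · exact absurd hU not_isUniqueUpToRigidMotion_fifteen
  · exact Or.inr ⟨1, 4, by norm_num, by norm_num⟩
  · exact absurd hU not_isUniqueUpToRigidMotion_seventeen
  · exact absurd hU not_isUniqueUpToRigidMotion_eighteen
  · exact Or.inl ⟨2, by norm_num⟩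
  · exact absurd hU (not_isUniqueUpToRigidMotion_hexagonal_add_one 2 le_rfl)
  · exact Or.inr ⟨2, 0, by norm_num, by norm_num⟩


/-! ## The remaining particle numbers with `s = 2`: `N = 23, 26, 29, 32, 35, 36` (Theorem 1.1 for `N ≤ 38`) -/

/-- **`N = 23`**: Harborth's `config 3 4` and a second maximal configuration with `52` contacts differ in
their number of `5`-valent discs. [cite: LucaFriesecke2017, Theorem 1.1 and §2 (p0003, p0005)] -/
theorem not_isUniqueUpToRigidMotion_twentythree : ¬ IsUniqueUpToRigidMotion 23 := by
  have hB : 2 * harborthNumber 23 = adjCount (config 3 4) :=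
    two_mul_harborthNumber_eq_adjCount_config (r := 3) (a := 4) (by norm_num) (by norm_num) (by norm_num)
  have hc : adjCount (config 3 4) = 104 := by decide +kernel
  have hc2 : adjCount ({((-3 : ℤ), (1 : ℤ)), ((-3 : ℤ), (2 : ℤ)), ((-2 : ℤ), (0 : ℤ)), ((-2 : ℤ), (1 : ℤ)), ((-2 : ℤ), (2 : ℤ)), ((-1 : ℤ), (-1 : ℤ)), ((-1 : ℤ), (0 : ℤ)), ((-1 : ℤ), (1 : ℤ)), ((-1 : ℤ), (2 : ℤ)), ((0 : ℤ), (-2 : ℤ)), ((0 : ℤ), (-1 : ℤ)), ((0 : ℤ), (0 : ℤ)), ((0 : ℤ), (1 : ℤ)), ((0 : ℤ), (2 : ℤ)), ((1 : ℤ), (-3 : ℤ)), ((1 : ℤ), (-2 : ℤ)), ((1 : ℤ), (-1 : ℤ)), ((1 : ℤ), (0 : ℤ)), ((1 : ℤ), (1 : ℤ)), ((2 : ℤ), (-3 : ℤ)), ((2 : ℤ), (-2 : ℤ)), ((2 : ℤ), (-1 : ℤ)), ((2 : ℤ), (0 : ℤ))} : Finset (ℤ × ℤ)) = 104 := by decide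 +kernel
  refine not_isUniqueUpToRigidMotion_of_card_filter_ne (S₁ := config 3 4)
    (S₂ := {((-3 : ℤ), (1 : ℤ)), ((-3 : ℤ), (2 : ℤ)), ((-2 : ℤ), (0 : ℤ)), ((-2 : ℤ), (1 : ℤ)), ((-2 : ℤ), (2 : ℤ)), ((-1 : ℤ), (-1 : ℤ)), ((-1 : ℤ), (0 : ℤ)), ((-1 : ℤ), (1 : ℤ)), ((-1 : ℤ), (2 : ℤ)), ((0 : ℤ), (-2 : ℤ)), ((0 : ℤ), (-1 : ℤ)), ((0 : ℤ), (0 : ℤ)), ((0 : ℤ), (1 : ℤ)), ((0 : ℤ), (2 : ℤ)), ((1 : ℤ), (-3 : ℤ)), ((1 : ℤ), (-2 : ℤ)), ((1 : ℤ), (-1 : ℤ)), ((1 : ℤ), (0 : ℤ)), ((1 : ℤ), (1 : ℤ)), ((2 : ℤ), (-3 : ℤ)), ((2 : ℤ), (-2 : ℤ)), ((2 : ℤ), (-1 : ℤ)), ((2 : ℤ), (0 : ℤ))})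
    (by decide +kernel) (by decide +kernel) hB.symm (by rw [hB, hc, hc2]) 5 ?_
  decide +kernel

/-- **`N = 26`**: Harborth's `config 3 7` and a second maximal configuration with `60` contacts differ in
their number of `5`-valent discs. [cite: LucaFriesecke2017, Theorem 1.1 and §2 (p0003, p0005)] -/
theorem not_isUniqueUpToRigidMotion_twentysix : ¬ IsUniqueUpToRigidMotion 26 := by
  have hB : 2 * harborthNumber 26 = adjCount (config 3 7) :=
    two_mul_harborthNumber_eq_adjCount_config (r := 3) (a := 7) (by norm_num) (by norm_num) (by norm_num)
  have hc : adjCount (config 3 7) = 120 := by decide +kernel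
  have hc2 : adjCount ({((-3 : ℤ), (0 : ℤ)), ((-3 : ℤ), (1 : ℤ)), ((-3 : ℤ), (2 : ℤ)), ((-2 : ℤ), (-1 : ℤ)), ((-2 : ℤ), (0 : ℤ)), ((-2 : ℤ), (1 : ℤ)), ((-2 : ℤ), (2 : ℤ)), ((-1 : ℤ), (-2 : ℤ)), ((-1 : ℤ), (-1 : ℤ)), ((-1 : ℤ), (0 : ℤ)), ((-1 : ℤ), (1 : ℤ)), ((-1 : ℤ), (2 : ℤ)), ((0 : ℤ), (-2 : ℤ)), ((0 : ℤ), (-1 : ℤ)), ((0 : ℤ), (0 : ℤ)), ((0 : ℤ), (1 : ℤ)), ((0 : ℤ), (2 : ℤ)), ((1 : ℤ), (-2 : ℤ)), ((1 : ℤ), (-1 : ℤ)), ((1 : ℤ), (0 : ℤ)), ((1 : ℤ), (1 : ℤ)), ((1 : ℤ), (2 : ℤ)), ((2 : ℤ), (-2 : ℤ)), ((2 : ℤ), (-1 : ℤ)), ((2 : ℤ), (0 : ℤ)), ((2 : ℤ), (1 : ℤ))} : Finset (ℤ × ℤ)) = 120 := by decide +kernel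
  refine not_isUniqueUpToRigidMotion_of_card_filter_ne (S₁ := config 3 7)
    (S₂ := {((-3 : ℤ), (0 : ℤ)), ((-3 : ℤ), (1 : ℤ)), ((-3 : ℤ), (2 : ℤ)), ((-2 : ℤ), (-1 : ℤ)), ((-2 : ℤ), (0 : ℤ)), ((-2 : ℤ), (1 : ℤ)), ((-2 : ℤ), (2 : ℤ)), ((-1 : ℤ), (-2 : ℤ)), ((-1 : ℤ), (-1 : ℤ)), ((-1 : ℤ), (0 : ℤ)), ((-1 : ℤ), (1 : ℤ)), ((-1 : ℤ), (2 : ℤ)), ((0 : ℤ), (-2 : ℤ)), ((0 : ℤ), (-1 : ℤ)), ((0 : ℤ), (0 : ℤ)), ((0 : ℤ), (1 : ℤ)), ((0 : ℤ), (2 : ℤ)), ((1 : ℤ), (-2 : ℤ)), ((1 : ℤ), (-1 : ℤ)), ((1 : ℤ), (0 : ℤ)), ((1 : ℤ), (1 : ℤ)), ((1 : ℤ), (2 : ℤ)), ((2 : ℤ), (-2 : ℤ)), ((2 : ℤ), (-1 : ℤ)), ((2 : ℤ), (0 : ℤ)), ((2 : ℤ), (1 : ℤ))})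
    (by decide +kernel) (by decide +kernel) hB.symm (by rw [hB, hc, hc2]) 5 ?_
  decide +kernel

/-- **`N = 29`**: Harborth's `config 3 10` and a second maximal configuration with `68` contacts differ in
their number of `5`-valent discs. [cite: LucaFriesecke2017, Theorem 1.1 and §2 (p0003, p0005)] -/
theorem not_isUniqueUpToRigidMotion_twentynine : ¬ IsUniqueUpToRigidMotion 29 := by
  have hB : 2 * harborthNumber 29 = adjCount (config 3 10) :=
    two_mul_harborthNumber_eq_adjCount_config (r := 3) (a := 10) (by norm_num) (by norm_num) (by norm_num)
  have hc : adjCount (config 3 10) = 136 := by decide +kernel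
  have hc2 : adjCount ({((-3 : ℤ), (0 : ℤ)), ((-3 : ℤ), (1 : ℤ)), ((-3 : ℤ), (2 : ℤ)), ((-3 : ℤ), (3 : ℤ)), ((-2 : ℤ), (-1 : ℤ)), ((-2 : ℤ), (0 : ℤ)), ((-2 : ℤ), (1 : ℤ)), ((-2 : ℤ), (2 : ℤ)), ((-2 : ℤ), (3 : ℤ)), ((-1 : ℤ), (-2 : ℤ)), ((-1 : ℤ), (-1 : ℤ)), ((-1 : ℤ), (0 : ℤ)), ((-1 : ℤ), (1 : ℤ)), ((-1 : ℤ), (2 : ℤ)), ((-1 : ℤ), (3 : ℤ)), ((0 : ℤ), (-2 : ℤ)), ((0 : ℤ), (-1 : ℤ)), ((0 : ℤ), (0 : ℤ)), ((0 : ℤ), (1 : ℤ)), ((0 : ℤ), (2 : ℤ)), ((1 : ℤ), (-2 : ℤ)), ((1 : ℤ), (-1 : ℤ)), ((1 : ℤ), (0 : ℤ)), ((1 : ℤ), (1 : ℤ)), ((2 : ℤ), (-2 : ℤ)), ((2 : ℤ), (-1 : ℤ)), ((2 : ℤ), (0 : ℤ)), ((3 : ℤ), (-2 : ℤ)), ((3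 : ℤ), (-1 : ℤ))} : Finset (ℤ × ℤ)) = 136 := by decide +kernel
  refine not_isUniqueUpToRigidMotion_of_card_filter_ne (S₁ := config 3 10)
    (S₂ := {((-3 : ℤ), (0 : ℤ)), ((-3 : ℤ), (1 : ℤ)), ((-3 : ℤ), (2 : ℤ)), ((-3 : ℤ), (3 : ℤ)), ((-2 : ℤ), (-1 : ℤ)), ((-2 : ℤ), (0 : ℤ)), ((-2 : ℤ), (1 : ℤ)), ((-2 : ℤ), (2 : ℤ)), ((-2 : ℤ), (3 : ℤ)), ((-1 : ℤ), (-2 : ℤ)), ((-1 : ℤ), (-1 : ℤ)), ((-1 : ℤ), (0 : ℤ)), ((-1 : ℤ), (1 : ℤ)), ((-1 : ℤ), (2 : ℤ)), ((-1 : ℤ), (3 : ℤ)), ((0 : ℤ), (-2 : ℤ)), ((0 : ℤ), (-1 : ℤ)), ((0 : ℤ), (0 : ℤ)), ((0 : ℤ), (1 : ℤ)), ((0 : ℤ), (2 : ℤ)), ((1 : ℤ), (-2 : ℤ)), ((1 : ℤ), (-1 : ℤ)), ((1 : ℤ), (0 : ℤ)), ((1 : ℤ), (1 : ℤ)), ((2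 : ℤ), (-2 : ℤ)), ((2 : ℤ), (-1 : ℤ)), ((2 : ℤ), (0 : ℤ)), ((3 : ℤ), (-2 : ℤ)), ((3 : ℤ), (-1 : ℤ))})
    (by decide +kernel) (by decide +kernel) hB.symm (by rw [hB, hc, hc2]) 5 ?_
  decide +kernel

/-- **`N = 32`**: Harborth's `config 3 13` and a second maximal configuration with `76` contacts differ in
their number of `5`-valent discs. [cite: LucaFriesecke2017, Theorem 1.1 and §2 (p0003, p0005)] -/
theorem not_isUniqueUpToRigidMotion_thirtytwo : ¬ IsUniqueUpToRigidMotion 32 := by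
  have hB : 2 * harborthNumber 32 = adjCount (config 3 13) :=
    two_mul_harborthNumber_eq_adjCount_config (r := 3) (a := 13) (by norm_num) (by norm_num) (by norm_num)
  have hc : adjCount (config 3 13) = 152 := by decide +kernel
  have hc2 : adjCount ({((-2 : ℤ), (0 : ℤ)), ((-2 : ℤ), (1 : ℤ)), ((-2 : ℤ), (2 : ℤ)), ((-2 : ℤ), (3 : ℤ)), ((-1 : ℤ), (-1 : ℤ)), ((-1 : ℤ), (0 : ℤ)), ((-1 : ℤ), (1 : ℤ)), ((-1 : ℤ), (2 : ℤ)), ((-1 : ℤ), (3 : ℤ)), ((0 : ℤ), (-2 : ℤ)), ((0 : ℤ), (-1 : ℤ)), ((0 : ℤ), (0 : ℤ)), ((0 : ℤ), (1 : ℤ)), ((0 : ℤ), (2 : ℤ)), ((0 : ℤ), (3 : ℤ)), ((1 : ℤ), (-3 : ℤ)), ((1 : ℤ), (-2 : ℤ)), ((1 : ℤ), (-1 : ℤ)), ((1 : ℤ), (0 : ℤ)), ((1 : ℤ), (1 : ℤ)), ((1 : ℤ), (2 : ℤ)), ((2 : ℤ), (-4 : ℤ)), ((2 : ℤ), (-3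 : ℤ)), ((2 : ℤ), (-2 : ℤ)), ((2 : ℤ), (-1 : ℤ)), ((2 : ℤ), (0 : ℤ)), ((2 : ℤ), (1 : ℤ)), ((3 : ℤ), (-4 : ℤ)), ((3 : ℤ), (-3 : ℤ)), ((3 : ℤ), (-2 : ℤ)), ((3 : ℤ), (-1 : ℤ)), ((3 : ℤ), (0 : ℤ))} : Finset (ℤ × ℤ)) = 152 := by decide +kernel
  refine not_isUniqueUpToRigidMotion_of_card_filter_ne (S₁ := config 3 13)
    (S₂ := {((-2 : ℤ), (0 : ℤ)), ((-2 : ℤ), (1 : ℤ)), ((-2 : ℤ), (2 : ℤ)), ((-2 : ℤ), (3 : ℤ)), ((-1 : ℤ), (-1 : ℤ)), ((-1 : ℤ), (0 : ℤ)), ((-1 : ℤ), (1 : ℤ)), ((-1 : ℤ), (2 : ℤ)), ((-1 : ℤ), (3 : ℤ)), ((0 : ℤ), (-2 : ℤ)), ((0 : ℤ), (-1 : ℤ)), ((0 : ℤ), (0 : ℤ)), ((0 : ℤ), (1 : ℤ)), ((0 : ℤ), (2 : ℤ)), ((0 : ℤ), (3 : ℤ)), ((1 : ℤ), (-3 : ℤ)),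 ((1 : ℤ), (-2 : ℤ)), ((1 : ℤ), (-1 : ℤ)), ((1 : ℤ), (0 : ℤ)), ((1 : ℤ), (1 : ℤ)), ((1 : ℤ), (2 : ℤ)), ((2 : ℤ), (-4 : ℤ)), ((2 : ℤ), (-3 : ℤ)), ((2 : ℤ), (-2 : ℤ)), ((2 : ℤ), (-1 : ℤ)), ((2 : ℤ), (0 : ℤ)), ((2 : ℤ), (1 : ℤ)), ((3 : ℤ), (-4 : ℤ)), ((3 : ℤ), (-3 : ℤ)), ((3 : ℤ), (-2 : ℤ)), ((3 : ℤ), (-1 : ℤ)), ((3 : ℤ), (0 : ℤ))})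
    (by decide +kernel) (by decide +kernel) hB.symm (by rw [hB, hc, hc2]) 5 ?_
  decide +kernel

/-- **`N = 35`**: Harborth's `config 3 16` and a second maximal configuration with `84` contacts differ in
their number of `5`-valent discs. [cite: LucaFriesecke2017, Theorem 1.1 and §2 (p0003, p0005)] -/
theorem not_isUniqueUpToRigidMotion_thirtyfive : ¬ IsUniqueUpToRigidMotion 35 := by
  have hB : 2 * harborthNumber 35 = adjCount (config 3 16) :=
    two_mul_harborthNumber_eq_adjCount_config (r := 3) (a := 16) (by norm_num) (by norm_num) (by norm_num)
  have hc : adjCount (config 3 16) = 168 := by decide +kernel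
  have hc2 : adjCount ({((-3 : ℤ), (0 : ℤ)), ((-3 : ℤ), (1 : ℤ)), ((-3 : ℤ), (2 : ℤ)), ((-3 : ℤ), (3 : ℤ)), ((-2 : ℤ), (-1 : ℤ)), ((-2 : ℤ), (0 : ℤ)), ((-2 : ℤ), (1 : ℤ)), ((-2 : ℤ), (2 : ℤ)), ((-2 : ℤ), (3 : ℤ)), ((-1 : ℤ), (-2 : ℤ)), ((-1 : ℤ), (-1 : ℤ)), ((-1 : ℤ), (0 : ℤ)), ((-1 : ℤ), (1 : ℤ)), ((-1 : ℤ), (2 : ℤ)), ((-1 : ℤ), (3 : ℤ)), ((0 : ℤ), (-3 : ℤ)), ((0 : ℤ), (-2 : ℤ)), ((0 : ℤ), (-1 : ℤ)), ((0 : ℤ), (0 : ℤ)), ((0 : ℤ), (1 : ℤ)), ((0 : ℤ), (2 : ℤ)), ((0 : ℤ), (3 : ℤ)), ((1 : ℤ), (-3 : ℤ)), ((1 : ℤ), (-2 : ℤ)), ((1 : ℤ), (-1 : ℤ)), ((1 : ℤ), (0 : ℤ)), ((1 : ℤ), (1 : ℤ)), ((1 : ℤ), (2 : ℤ)), ((2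 : ℤ), (-3 : ℤ)), ((2 : ℤ), (-2 : ℤ)), ((2 : ℤ), (-1 : ℤ)), ((2 : ℤ), (0 : ℤ)), ((2 : ℤ), (1 : ℤ)), ((3 : ℤ), (-2 : ℤ)), ((3 : ℤ), (-1 : ℤ))} : Finset (ℤ × ℤ)) = 168 := by decide +kernel
  refine not_isUniqueUpToRigidMotion_of_card_filter_ne (S₁ := config 3 16)
    (S₂ := {((-3 : ℤ), (0 : ℤ)), ((-3 : ℤ), (1 : ℤ)), ((-3 : ℤ), (2 : ℤ)), ((-3 : ℤ), (3 : ℤ)), ((-2 : ℤ), (-1 : ℤ)), ((-2 : ℤ), (0 : ℤ)), ((-2 : ℤ), (1 : ℤ)), ((-2 : ℤ), (2 : ℤ)), ((-2 : ℤ), (3 : ℤ)), ((-1 : ℤ), (-2 : ℤ)), ((-1 : ℤ), (-1 : ℤ)), ((-1 : ℤ), (0 : ℤ)), ((-1 : ℤ), (1 : ℤ)), ((-1 : ℤ), (2 : ℤ)), ((-1 : ℤ), (3 : ℤ)), ((0 : ℤ), (-3 : ℤ)), ((0 : ℤ), (-2 : ℤ)), ((0 : ℤ), (-1 : ℤ)),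 ((0 : ℤ), (0 : ℤ)), ((0 : ℤ), (1 : ℤ)), ((0 : ℤ), (2 : ℤ)), ((0 : ℤ), (3 : ℤ)), ((1 : ℤ), (-3 : ℤ)), ((1 : ℤ), (-2 : ℤ)), ((1 : ℤ), (-1 : ℤ)), ((1 : ℤ), (0 : ℤ)), ((1 : ℤ), (1 : ℤ)), ((1 : ℤ), (2 : ℤ)), ((2 : ℤ), (-3 : ℤ)), ((2 : ℤ), (-2 : ℤ)), ((2 : ℤ), (-1 : ℤ)), ((2 : ℤ), (0 : ℤ)), ((2 : ℤ), (1 : ℤ)), ((3 : ℤ), (-2 : ℤ)), ((3 : ℤ), (-1 : ℤ))})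
    (by decide +kernel) (by decide +kernel) hB.symm (by rw [hB, hc, hc2]) 5 ?_
  decide +kernel

/-- **`N = 36`**: Harborth's `config 3 17` and a second maximal configuration with `87` contacts differ in
their number of `5`-valent discs. [cite: LucaFriesecke2017, Theorem 1.1 and §2 (p0003, p0005)] -/
theorem not_isUniqueUpToRigidMotion_thirtysix : ¬ IsUniqueUpToRigidMotion 36 := by
  have hB : 2 * harborthNumber 36 = adjCount (config 3 17) :=
    two_mul_harborthNumber_eq_adjCount_config (r := 3) (a := 17) (by norm_num) (by norm_num) (by norm_num)
  have hc : adjCount (config 3 17) = 174 := by decide +kernel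
  have hc2 : adjCount ({((-2 : ℤ), (-1 : ℤ)), ((-2 : ℤ), (0 : ℤ)), ((-2 : ℤ), (1 : ℤ)), ((-2 : ℤ), (2 : ℤ)), ((-2 : ℤ), (3 : ℤ)), ((-1 : ℤ), (-2 : ℤ)), ((-1 : ℤ), (-1 : ℤ)), ((-1 : ℤ), (0 : ℤ)), ((-1 : ℤ), (1 : ℤ)), ((-1 : ℤ), (2 : ℤ)), ((-1 : ℤ), (3 : ℤ)), ((0 : ℤ), (-3 : ℤ)), ((0 : ℤ), (-2 : ℤ)), ((0 : ℤ), (-1 : ℤ)), ((0 : ℤ), (0 : ℤ)), ((0 : ℤ), (1 : ℤ)), ((0 : ℤ), (2 : ℤ)), ((0 : ℤ), (3 : ℤ)), ((1 : ℤ), (-3 : ℤ)), ((1 : ℤ), (-2 : ℤ)), ((1 : ℤ), (-1 : ℤ)), ((1 : ℤ), (0 : ℤ)), ((1 : ℤ), (1 : ℤ)), ((1 : ℤ), (2 : ℤ)), ((2 : ℤ), (-3 : ℤ)), ((2 : ℤ), (-2 : ℤ)), ((2 : ℤ), (-1 : ℤ)), ((2 : ℤ), (0 : ℤ)), ((2 :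 ℤ), (1 : ℤ)), ((3 : ℤ), (-3 : ℤ)), ((3 : ℤ), (-2 : ℤ)), ((3 : ℤ), (-1 : ℤ)), ((3 : ℤ), (0 : ℤ)), ((4 : ℤ), (-3 : ℤ)), ((4 : ℤ), (-2 : ℤ)), ((4 : ℤ), (-1 : ℤ))} : Finset (ℤ × ℤ)) = 174 := by decide +kernel
  refine not_isUniqueUpToRigidMotion_of_card_filter_ne (S₁ := config 3 17)
    (S₂ := {((-2 : ℤ), (-1 : ℤ)), ((-2 : ℤ), (0 : ℤ)), ((-2 : ℤ), (1 : ℤ)), ((-2 : ℤ), (2 : ℤ)), ((-2 : ℤ), (3 : ℤ)), ((-1 : ℤ), (-2 : ℤ)), ((-1 : ℤ), (-1 : ℤ)), ((-1 : ℤ), (0 : ℤ)), ((-1 : ℤ), (1 : ℤ)), ((-1 : ℤ), (2 : ℤ)), ((-1 : ℤ), (3 : ℤ)), ((0 : ℤ), (-3 : ℤ)), ((0 : ℤ), (-2 : ℤ)), ((0 : ℤ), (-1 : ℤ)), ((0 : ℤ), (0 : ℤ)), ((0 : ℤ), (1 : ℤ)), ((0 : ℤ), (2 : ℤ)), ((0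 : ℤ), (3 : ℤ)), ((1 : ℤ), (-3 : ℤ)), ((1 : ℤ), (-2 : ℤ)), ((1 : ℤ), (-1 : ℤ)), ((1 : ℤ), (0 : ℤ)), ((1 : ℤ), (1 : ℤ)), ((1 : ℤ), (2 : ℤ)), ((2 : ℤ), (-3 : ℤ)), ((2 : ℤ), (-2 : ℤ)), ((2 : ℤ), (-1 : ℤ)), ((2 : ℤ), (0 : ℤ)), ((2 : ℤ), (1 : ℤ)), ((3 : ℤ), (-3 : ℤ)), ((3 : ℤ), (-2 : ℤ)), ((3 : ℤ), (-1 : ℤ)), ((3 : ℤ), (0 : ℤ)), ((4 : ℤ), (-3 : ℤ)), ((4 : ℤ), (-2 : ℤ)), ((4 : ℤ), (-1 : ℤ))})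
    (by decide +kernel) (by decide +kernel) hB.symm (by rw [hB, hc, hc2]) 5 ?_
  decide +kernel

/-- **De Luca–Friesecke's Theorem 1.1 holds for `N ≤ 38`**: among `1 ≤ N ≤ 38` the minimizer is unique up
to rotation and translation exactly for `N ∈ {1, 2, 3, 4, 5, 7, 8, 10, 12, 14, 16, 19, 21, 24, 27, 30, 33, 37}`.
[cite: LucaFriesecke2017, Theorem 1.1 (p0003)] -/
theorem uniqueness_iff_of_le_thirtyeight {N : ℕ} (h1 : 1 ≤ N) (h38 : N ≤ 38) :
    IsUniqueUpToRigidMotion N ↔ IsUniqueParticleNumber N := by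
  refine ⟨fun hU => ?_, isUniqueUpToRigidMotion_of_isUniqueParticleNumber⟩
  interval_cases N
  · exact Or.inl ⟨0, by norm_num⟩
  · exact Or.inr ⟨0, 1, by norm_num, by norm_num⟩
  · exact Or.inr ⟨0, 2, by norm_num, by norm_num⟩
  · exact Or.inr ⟨0, 3, by norm_num, by norm_num⟩
  · exact Or.inr ⟨0, 4, by norm_num, by norm_num⟩
  · exact absurd hU not_isUniqueUpToRigidMotion_six
  · exact Or.inl ⟨1, by norm_num⟩
  · exact Or.inr ⟨1, 0, by norm_num, by norm_num⟩
  · exact absurd hU not_isUniqueUpToRigidMotion_nine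
  · exact Or.inr ⟨1, 1, by norm_num, by norm_num⟩
  · exact absurd hU not_isUniqueUpToRigidMotion_eleven
  · exact Or.inr ⟨1, 2, by norm_num, by norm_num⟩
  · exact absurd hU not_isUniqueUpToRigidMotion_thirteen
  · exact Or.inr ⟨1, 3, by norm_num, by norm_num⟩
  · exact absurd hU not_isUniqueUpToRigidMotion_fifteen
  · exact Or.inr ⟨1, 4, by norm_num, by norm_num⟩
  · exact absurd hU not_isUniqueUpToRigidMotion_seventeen
  · exact absurd hU not_isUniqueUpToRigidMotion_eighteen
  · exact Or.inl ⟨2, by norm_num⟩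
  · exact absurd hU (not_isUniqueUpToRigidMotion_hexagonal_add_one 2 le_rfl)
  · exact Or.inr ⟨2, 0, by norm_num, by norm_num⟩
  · have h := not_isUniqueUpToRigidMotion_hexagonal_add_mul 2 1 (by norm_num) (by norm_num) (by norm_num)
    norm_num at h
    exact absurd hU h
  · exact absurd hU not_isUniqueUpToRigidMotion_twentythree
  · exact Or.inr ⟨2, 1, by norm_num, by norm_num⟩
  · have h := not_isUniqueUpToRigidMotion_hexagonal_add_mul 2 2 (by norm_num) (by norm_num) (by norm_num)
    norm_num at h
    exact absurd hU h
  · exact absurd hU not_isUniqueUpToRigidMotion_twentysix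
  · exact Or.inr ⟨2, 2, by norm_num, by norm_num⟩
  · have h := not_isUniqueUpToRigidMotion_hexagonal_add_mul 2 3 (by norm_num) (by norm_num) (by norm_num)
    norm_num at h
    exact absurd hU h
  · exact absurd hU not_isUniqueUpToRigidMotion_twentynine
  · exact Or.inr ⟨2, 3, by norm_num, by norm_num⟩
  · have h := not_isUniqueUpToRigidMotion_hexagonal_add_mul 2 4 (by norm_num) (by norm_num) (by norm_num)
    norm_num at h
    exact absurd hU h
  · exact absurd hU not_isUniqueUpToRigidMotion_thirtytwo
  · exact Or.inr ⟨2, 4, by norm_num, by norm_num⟩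
  · have h := not_isUniqueUpToRigidMotion_hexagonal_add_mul 2 5 (by norm_num) (by norm_num) (by norm_num)
    norm_num at h
    exact absurd hU h
  · exact absurd hU not_isUniqueUpToRigidMotion_thirtyfive
  · exact absurd hU not_isUniqueUpToRigidMotion_thirtysix
  · exact Or.inl ⟨3, by norm_num⟩
  · have h := not_isUniqueUpToRigidMotion_hexagonal_add_one 3 (by norm_num)
    norm_num at h
    exact absurd hU h

end Literature.MathematicalPhysics.StatisticalMechanics.LucaFriesecke2017

end
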